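import Summits.Parity.BatemanHorn.Theses.SelbergDelangeRigidity
import Literature.NumberTheory.LFunctions.SelbergDelangeOmega

/-!
# Disproof work file for crux `NormalFamilyBound` (stmt-Parity-9769), route SelbergDelangeRigidity

Standing disprover (cdisprove): cycle 1 refuter-cdisprove-stmt-Parity-9769-0, cycle 2 (gen 2)
refuter-cdisprove-stmt-Parity-9769-g2-0 (2026-08-16). Lean only; prose lives in docstrings. `lean check` rc 0,
0 sorry, axioms ⊆ {propext, Classical.choice, Quot.sound}. Cycle-2 additions are the four `## Cycle 2` sections at
the end (uniformity in `f`, the majorant family, the real-point calibration, the `f = (X)` calibration from the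
printed Selberg–Delange law) and the bullets marked (c2) below.

Crux: `∀ k f, IsBatemanHornSystem f → ∃ η ∈ (0, 1/4], {H_x}_x locally bounded on V_η = {−η < Re z < 7/4,
|Im z| < η}`, `H_x(z) = x⁻¹ (log x)^{k(1−z)} Σ_{n ≤ x} z^{Ω_f(n)}`, `Ω_f(n) = Σ_i Ω(toNat (f_i(n)))`.

## VERDICT SO FAR (end of cycle 2): RESISTS — no kill, and none is available by cheap means

(c2) WHY IT RESISTS, in one paragraph. The crux is the statement that the normalised Ω-generating family of a
Bateman–Horn system is a normal family on a thin neighbourhood of `[0, 7/4)`. (i) It is CONSISTENT: for the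
integers it is exactly the printed theorem (`locallyBounded_fX_of_MV`: MV Thm 7.18 ⇒ the `k = 1`, `f = X`
instance, with the crux's own normalisation and junk terms — so no mis-normalisation / junk leak exists to
exploit), the `k = 0` instance is true, and every local Euler factor `E_p(z)` of every BH system has radius
`≥ p ≥ 2 > 1.77 ≥ sup_V |z|` (coprime components share no deep `p`-adic root: resultants; a separable
component has boundedly many roots mod `p^v`: Hensel), so the conjectural limit `λ_f(z)D^{z−1}Γ(z)^{−k}` is
holomorphic on a neighbourhood of the closure of `V`. (ii) A refutation needs an Ω-THEOREM: a point `z₀ ∈ V_η`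
(for every η, so in effect a point of `[0,7/4)` approached from ℂ) where `Σ_{n≤x} z₀^{Ω_f(n)}` fails to save
`(log x)^{k(|z₀|−Re z₀)}` over the trivial bound infinitely often. On the real segment the positive-weight order
of magnitude is KNOWN (Nair–Tenenbaum), so `z₀` must be genuinely complex or negative, where NO lower-bound
technology for such sums along polynomial values exists in print (it would be an anti-correlation theorem for
`z^{Ω}` along `f`, i.e. a disproof of a Chowla/Elliott-type expectation). (iii) Random-model sanity: even with
INDEPENDENT random phases the fluctuation of `Σ z^{Ω_f(n)}` is `√x (log x)^{k(|z|²−1)/2}`, which after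
normalisation is `x^{−1/2}(log x)^{O(k)} → 0` — randomness alone never produces a blow-up inside `|z| < 2`;
only a CONSPIRACY of the phases `e^{iθΩ_f(n)}` could, and Bateman–Horn heuristics forbid it. (iv) Everything
cheap has been converted into refuted STRENGTHENINGS instead (radius/left end/height ≥ 2, uniformity in `f`,
the majorant family, dropped hypotheses), each witnessed by `(X)` or a degree-one translate.

* Read-back finds no junk leak: `(0:ℂ)⁻¹ = 0`, `log log x` finite for x ≤ 2, `toNat` of negatives and
  `Ω 0 = Ω 1 = 0` touch finitely many `n` for a BH system; each `H_x` is entire so finitely many `x` never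
  matter; quantifier order ∃η ∀a ∃M ∃r ∀x ∀z is local boundedness; `η ≤ 1/4` is cosmetic
  (`locallyBounded_iff_exists_pos`) and only serves `V ⊆ ball 0 2` (`V_subset_ball_two`).
* Local Euler factors never obstruct below radius 2 for ANY system: the density of
  `{n : Σ_i v_p(f_i(n)) ≥ V}` is `O_f(p^{−V})` (distinct irreducible components are coprime, so at most
  one `f_i(n)` is highly divisible by `p`; Hensel beyond `v_p(disc)`), hence `E_p(z) = E z^{Σ_i v_p(f_i(n))}`
  converges on `|z| < p`, and `V_η ⊂ {|z| < 2}`. The right end `7/4` is essentially sharp: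
  `normalFamilyBoundRadius_false` (any `R > 2` fails for `f = (X)`).
* The substance (complex `z` off the positive axis, and `−η < Re z ≤ 0`) is the uniform
  Landau–Selberg–Delange law along `f`; for `f = (X)` it is Montgomery–Vaughan Thm 7.18 (vendored fact
  `Literature.NumberTheory.LFunctions.MontgomeryVaughan2007_thm_7_18_Omega`); for `deg ≥ 2` or `k ≥ 2` it is
  open in both directions (no Ω-theorem against log-power cancellation of signed almost-prime counts along a
  polynomial is in print; Chowla-along-f is open both ways). NUMERICS (§ Numerics below) follow the
  conjectural limit `λ_f(z) D^{z−1}/Γ(z)^k` to within 10–25 % at x = 3·10⁶ at every tested point of V,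
  INCLUDING the negative axis and the corners `−0.15 ± 0.15 i`, for X²+1, X²+X+1, (X, X+2), (X, 2X+1),
  (X, X²+X+1), with the same slow monotone drift as the known case `f = (X)`; the trivial bound would have
  grown by ×1.36 … ×1.93 over the range and no such growth is seen. So the one mechanism that could kill the
  frame cheaply — an Ω-oscillation at some z₀ — does not show up at this scale.

## Findings index (theorems below)

* `normalFamilyBound_iff`, `normalFamilyBoundRadius_iff` — the crux = `R = 7/4` instance, definitional.
* `not_locallyBounded_of_unbounded` — REDUCTION: one real `a ∈ [0, R)` with `sup_x ‖H_x(a)‖ = ∞` kills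
  local boundedness for EVERY η (the prover's freedom in η is worthless against a real-axis blow-up);
  `norm_H_ofReal` — on the real axis the weights `a^{Ω_f(n)} ≥ 0` cannot cancel.
* LOAD-BEARING (§ Load-bearing): `normalFamilyBound_false_without_irreducible` (`f = (1)`: `H_x(0) =
  (x+1)x⁻¹ log x`; and `…'`: `f = (X²)`, `Ω(n²) = 2Ω(n)`, blow-up at `a = 3/2`),
  `…_without_leadingCoeffPos` (`f = (−X)`, `toNat` junk makes `Ω_f ≡ 0`), `…_without_pairwiseNotAssociated`
  (`f = (X, X)`: `(3/2)² = 9/4 > 2` crosses the `p = 2` radius, `‖H_{2^m}(3/2)‖ ≥ (9/8)^m/(m log 2)`),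
  `…_without_noFixedPrimeDivisor` (`f = (2)`: `Ω_f ≡ 1`, `H_x(1/2) ≍ (log x)^{1/2}`). NOTE: the last field is
  only shown necessary through a CONSTANT; for non-constant systems with a fixed prime divisor (e.g.
  `X² + X + 2`) the family is plausibly still locally bounded — `hasNoFixedPrimeDivisor` is possibly
  unnecessary for THIS crux (it matters for Bateman–Horn through `C(f) > 0`).
* TIGHTNESS (§ Tightness): `normalFamilyBoundRadius_false` — `7/4 ↦ R` is false for every `R > 2`, already
  for the genuine BH system `f = (X)` (triage r1-1 finding F1 / MV "R < 2 is necessary", formalised).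
* SANITY: `locallyBounded_empty` — `k = 0` is TRUE (`H_x = (x+1)/x ≤ 2`); `z = 0`: `H_x(0) → 0`.
* STRUCTURE: `locallyBounded_iff_exists_pos` (cap cosmetic), `V_subset_ball_two`;
  EXCHANGE RATE `norm_H_le_exchange`: `‖H_x(z)‖ ≤ (log x)^{k(|z|−Re z)} · H_x(|z|)` exactly, and the dial
  `norm_sub_re_lt_of_mem_V`: `|z| − Re z < 3η` on `V_{R,η}` — so on `Re z > 0` the crux asks only a
  `(log x)^{3kη}` saving over the positive-weight (Nair–Tenenbaum) order of magnitude, η the prover's choice.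
* `-- Targets`: none yet (no line picked at cycle 2 either, `stuck_stubs = []`).
* (c2) UNIFORMITY IN `f` IS FALSE (§ Cycle 2 / uniformity): `normalFamilyBound_not_uniform_in_f` — at any single
  `x ≥ 1` and the single real point `3/2`, `sup_c ‖H^{(X+c)}_x(3/2)‖ = ∞` over the degree-one BH systems `(X + c)`
  (`c = 2^m − x` puts the value `2^m` at `n = x`); `not_normalFamilyBound_uniform` refutes the crux with `η, M, r`
  depending on `k` only. Constants must depend on the height of `f` (crude shadow of Friedlander–Granville).
* (c2) THE TRIANGLE INEQUALITY IS HOPELESS (§ Cycle 2 / majorant): `norm_H_le_Habs` (the majorant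
  `x⁻¹(log x)^{k(1−Re z)} Σ_n |z|^{Ω_f(n)}`), `Habs_unbounded` + `exists_mem_V_norm_eq_one` ⇒
  `Habs_not_locallyBoundedOn`: for EVERY system with `k ≥ 1` and EVERY `η`, the majorant family blows up at
  `e^{iθ} ∈ V_η` (there `Σ_n |z|^{Ω} = x + 1` and the normaliser is `(log x)^{k(1−cos θ)} → ∞`);
  `not_normalFamilyBound_abs` refutes the majorant version of the crux via `(X)`. So the saving
  `(log x)^{k(|z|−Re z)}` must come from cancellation among the phases `e^{iθ Ω_f(n)}` — the exchange rate of
  `norm_H_le_exchange` is attained by the majorant, not an artefact.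
* (c2) CALIBRATION OF A REAL POINT (§ Cycle 2 / sieve): `card_primeTuples_le_of_locallyBounded` — a bound
  `‖H_x(ε)‖ ≤ M` at real `0 < ε < 7/4` is the upper-bound-sieve estimate
  `#{n ≤ x : all f_i(n) prime} ≤ M ε^{−k} x (log x)^{−k(1−ε)}`; the real segment is sieve-strength (known), the
  parity content is off the segment.
* (c2) SHAPE OF THE TARGET (§ Cycle 2 / shape): `locallyBounded_of_uniform` (one bound on some `V_{R,η}` suffices —
  the form a proof will take), `uniform_of_locallyBoundedOn` (finite subcover: the crux's ball form gives one constant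
  on every closed `[−η',R'] × [−η',η']`, `η' < η`, `R' < R`), `uniform_on_closedRectangle_of_normalFamilyBound`.
* (c2) CALIBRATION AT `f = (X)` (§ Cycle 2 / MV): `locallyBounded_fX_of_MV` — the vendored fact
  `MontgomeryVaughan2007_thm_7_18_Omega` implies `LocallyBounded (7/4) 1 fX` (global bound `48 + 4 + |C| + K` on
  `V_{7/4,1/4}`; `norm_G_le`: the fact at `x = 2` bounds `F(1,z)/Γ(z)` uniformly on `|z| ≤ 9/5`, so no continuity
  of the Euler product is needed; small `x ≤ 2` by hand, `|log log 2| ≤ 1`).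
* NATURAL BOUNDARY (§ Natural boundary): `fX_unbounded_of_two_lt_norm` — for `f = (X)` and EVERY `z` with
  `‖z‖ > 2`, `sup_x ‖H_x(z)‖ = ∞` (jump `z^m` at `n = 2^m`: no lower-bound technology needed); SHARP
  corollaries `normalFamilyBoundRadius_false_of_two_le` (`7/4 ↦ R` fails for every `R ≥ 2`: the thin
  rectangle pokes out of the disc at `(2 − η²/32) + iη/2` whatever η the prover picks),
  `normalFamilyBoundLeft_false_of_two_le` (`−η ↦ −R'` fails for every `R' ≥ 2`), `normalFamilyBoundTall_false`
  (height `> 1`). So the thin rectangle STRICTLY inside `|z| < 2` is forced in every direction already by the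
  integers; only its thickness `η` and the corner `7/4 < 2` are choices.
* NEAR-MISSES: none claimed (nothing is sorried). The "uniform in f" strengthening, left open at cycle 1, is now
  refuted cheaply (translates, no lower-bound technology needed).
* (c2) STRUCTURE OF THE CONJECTURAL LIMIT (paper/numerics, not Lean; for ideators and leads). For an admissible
  `k`-tuple of linear forms with all shifts even (`(X, X+2)`, `(X, X+2, X+6)`, …, e.g. the `k = 10` tuple
  `{0,2,6,8,12,18,20,26,30,32}`) one has `E[V_2] = k` exactly and `E_2(z) = 1/2 + z^k(…)/2`; the local factor
  `E_2`, hence `λ_f`, has a ZERO at `z₀ ≈ e^{iπ/(2k)}` (found numerically: `k = 4: 0.954+0.399i`, `6: 0.985+0.264i`,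
  `7: 0.982+0.224i`, `8: 0.986+0.196i`, `10: 0.990+0.157i`, `12: 0.993+0.131i`; `|z₀|` slightly `> 1`). So for
  `k ≥ 7` the conjectural limit `λ_f(z)D^{z−1}Γ(z)^{−k}` of `H_x` VANISHES at a point of `V_{1/4} ∩ {Re z ≈ 1}`, and
  as `k → ∞` such zeros approach the trivial point `z = 1` like `π/(2k)`. Harmless for the crux (a zero of the limit
  is bounded) and for Vitali, but every strategy through `log S_x(z)` or `S_x'/S_x` (card renewal-phase-bootstrap:
  arcs `|z| = r` from the real axis — the arc `|z| = 1` runs into `z₀`) pays constants `≍ e^{K}` at each near-zero,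
  growing with `k`; and `η(f)` smaller than `π/(2k)` keeps the zeros outside `V_η`.
* (c2) TRIAGE INPUT filed (`Cruxes/NormalFamilyBound/DisproverNoteTiltedDiscrepancy.md`): card
  tilt-recentred-expansion's transfer target `TiltedDiscrepancy`(ii) is MISSTATED — its model `m : ℕ → ℝ` is chosen
  before `x`, but at linear scales `d = x^u` the relative class densities carry the room factor `(1−u)^{k(y−1)}`
  (for `f = (X)`: `A_p(x)/A_1(x) = (y/p)(1−u)^{y−1}(1 + O(1/log x))` exactly, by MV Thm 7.18), so comparing (ii) at
  `x` and `x³` over `p ∈ (x^{1/3}, x^{1/2}]` forces `0.04η ≤ 2C(3 log x)^{η−δ} → 0` for `δ > η` (⊇ the transfer's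
  `δ ≥ 2kη`): false for `(X)`; repair = x-dependent model `m(d, x) = g(d)φ_y(log d/log x)`, after which (i) must be
  restated with the profile.

## Barriers (catalogue `Literature/Barriers/Parity/`) — none yields a refutation
Barriers constrain PROOFS, not truth: `SelbergParityBarrier` (Type-I data cannot see the sign of
`(−t)^{Ω}` — applies to any sieve-only proof of the `Re z ≤ 0` half, says nothing about the values of a
polynomial); `UniformBatemanHornBarrier` / `FriedlanderGranvilleUniformity` (failure of UNIFORM-in-`f`
asymptotics at `x ≍ (log h(f))^B` — not engaged: here `η, M, r` depend on `f`); `FordMaynardPrimeSieves*`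
(Type I/II derivations — nothing is derived). `ledger negatives --problem Parity` (3 entries) untouched.

## Numerics (this seat, pure Python, N = 3·10⁶; kit job j008500 queued for N = 10⁷ prefix histograms)

`|H_x(z)|` at x = 10³, 10⁴, 10⁵, 10⁶, 3·10⁶ ‖ conjectured `|λ_f(z) D^{z−1} Γ(z)^{−k}|` (λ via local factors
E_p, p ≤ 10⁶; for (X) this is MV 7.18's `F(1,z)/Γ(z)`):
```
f = (X)        z=−0.2: .218 .225 .218 .211 .209 ‖ .185   z=0.2i: .229 .227 .223 .220 .219 ‖ .205
               z=1.5 : 1.53 1.61 1.66 1.69 1.70 ‖ 1.82   z=1.7+.2i: 1.78 1.96 2.07 2.14 2.17 ‖ 2.34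
f = (X²+1)     z=−0.2: .096 .112 .118 .113 .110 ‖ .100   z=0.2i: .164 .164 .160 .157 .156 ‖ .145
               z=−.15+.15i: .130 .139 .139 .135 .133 ‖ .121   z=1.5: 1.222 1.216 1.213 1.210 1.209 ‖ 1.199
               z=1.7+.2i: 1.254 1.242 1.235 1.230 1.229 ‖ 1.206   z=e^{.3i}: 1.041 1.043 1.045 1.046 1.047 ‖ 1.052
f = (X²+X+1)   z=−0.2: .225 .239 .221 .216 .213 ‖ .192   z=1.5: 1.043 1.037 1.032 1.029 1.028 ‖ 1.014
f = (X, X+2)   z=−0.2: .002 .058 .058 .055 .057 ‖ .044   z=0.2i: .066 .072 .070 .068 .067 ‖ .058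
               z=1.5 : 2.29 2.49 2.59 2.66 2.68 ‖ 2.90   z=1.7+.2i: 3.03 3.50 3.75 3.90 3.96 ‖ 4.36
f = (X, 2X+1)  z=−0.2: .149 .075 .057 .046 .045 ‖ .040   z=1.5: 1.44 1.47 1.48 1.49 1.49 ‖ 1.50  (D = 1)
f = (X, X²+X+1) z=−0.2: .110 .042 .026 .022 .022        z=1.5: 1.56 1.63 1.66 1.67 1.68         (D = 2)
```
Growth factor of the TRIVIAL bound `(log x)^{k(|z|−Re z)}` over the same range: ×1.36 (k=1, z=−0.2),
×1.85 (k=2), ×1.93 (k=2 corner) — absent from every row.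

## Numerics, cycle 2 (kit j011034 + j011036, numpy root sieve; script num/hfamily.py in the seat folder)

`|H_x(z)|` at x = 10⁴, 10⁵, 10⁶, 10⁷ (cubic: 10⁴..10⁶) ‖ `|λ_f(z)D^{z−1}Γ(z)^{−k}|` (exact local factors `p ≤ 50`,
simple-root formula to `10⁶`); `Habs` = the triangle-inequality majorant at the first/last x; `pv` = phase-velocity
deficit `k r|sin θ| log log x − sign θ · Im E_z[Ω_f]` of card renewal-phase-bootstrap (must stay bounded above):
```
(X) k=1          −0.25: .282 .269 .260 .253 ‖ .224  Habs .84→1.08 | 0.3i: .344 .340 .336 .333 ‖ .316 pv +.03→+.00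
                 e^.25i: .987 .985 .984 .983 ‖ .980 pv −.10→−.12  | 1.5+.2i: 1.59 1.63 1.64 1.65 ‖ 1.70 pv −.34→−.76
                 1.5e^.5i: 1.24 1.20 1.19 1.18 ‖ 1.12 pv −.75→−.56 | 1.7+.2i: 1.96 2.07 2.14 2.19 ‖ 2.34
                 i(∉V): 1.31 1.36 1.40 1.43 ‖ 1.56 Habs 9.2→16  | −1(∉V): .79 .38 .10 .022 ‖ 0 (PNT)
(X²+1) k=1       −0.25: .126 .136 .128 .124 ‖ .113 Habs .72→.92  | 0.3i: .264 .254 .251 .248 ‖ .232 pv −.25→−.29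
                 e^.25i: 1.03 1.03 1.03 1.03 ‖ 1.04 pv +.23→+.25  | 1.5+.2i: 1.24 1.23 1.23 1.23 ‖ 1.22 pv +.24→+.27
                 1.5e^.5i: 1.52 1.53 1.54 1.54 ‖ 1.59 pv +.85→+.95 | 1.7+.2i: 1.24 1.24 1.23 1.23 ‖ 1.21
                 i(∉V): 1.90 1.97 1.96 1.96 ‖ 1.93 Habs 9.2→16  | −1(∉V): .48 .56 .11 .014 ‖ 0 (Chowla along n²+1, fine)
(X,X+2) k=2      −0.25: .085 .084 .079 .082 ‖ .063 Habs .89→1.44 | 0.3i: .177 .173 .168 .163 ‖ .143 pv +.17→+.10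
                 e^.25i: .957 .954 .952 .951 ‖ .946 pv −.36→−.41  | 1.5+.2i: 2.51 2.59 2.63 2.66 ‖ 2.78 pv −.21→−.61
                 1.5e^.5i: 2.16 2.07 2.05 2.05 ‖ 2.04 pv −.38→−.25 | 1.7+.2i: 3.50 3.75 3.90 4.01 ‖ 4.36
                 i(∉V): 6.8 7.3 7.7 7.9 ‖ 8.6 Habs 85→260       | −1(∉V): noise (7.9, 45, 2.4, 8.4)
(X,X+2,X+6) k=3  −0.25: .007 .032 .052 .050 ‖ .036 Habs 1.4→2.8 | 0.3i: .147 .135 .127 .121 ‖ .099 pv +.62→+.33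
                 e^.25i: .844 .837 .832 .830 ‖ .814 pv −1.5→−1.7  | 1.5+.2i: 4.77 5.00 5.13 5.21 ‖ 5.61 pv +.02→−.40
                 1.5e^.5i: 5.21 5.08 5.22 5.31 ‖ 5.97 pv +1.2→+1.7 | 1.7+.2i: 8.08 8.90 9.39 9.71 ‖ 10.9
                 i(∉V): 10.3 12.0 14.0 14.7 ‖ 21.1 Habs 781→4187  | −1(∉V): noise (10³–10⁴)
(X³+2) k=1 D=3   −0.25: .073 .067 .070 ‖ .062 | 0.3i: .164 .161 .158 ‖ .147 pv −.45→−.45 | e^.25i: 1.02 1.02 1.02 ‖ 1.02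
                 1.5+.2i: 1.50 1.51 1.51 ‖ 1.52 | 1.5e^.5i: 1.74 1.76 1.77 ‖ 1.83 pv +.65→+.70 | 1.7+.2i: 1.62 1.62 1.62 ‖ 1.62
```
EXTENSION TO 10⁸ for X²+1 (kit j011036, 617 s; the extension card renewal-phase-bootstrap's falsifier (2) asked for):
`|H|` at x = 10⁷, 3·10⁷, 10⁸: −0.25: .124 .123 .122 (‖ .113); 0.3i: .248 .247 .246 (‖ .232), pv −.290 −.292 −.295;
1.5e^{.5i}: 1.545 1.547 1.550 (‖ 1.586), pv .949 .957 .965; 1.7+.2i: 1.227 1.226 1.224 (‖ 1.206); i(∉V): 1.956 1.956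
1.956 (‖ 1.927); −1(∉V): .014 .067 .060 (noise ≍ x^{−1/2}(log x)²·O(1)). pv moved by .005 / .016 per decade (< .05, as
the card predicts); `#{n ≤ 10⁸ : n²+1 prime} = 3 954 181`.
READING. (1) No anomaly anywhere: every row in or near `V` is flat/monotone and within 10–25 % of the conjectural limit,
drifting towards it at the same `O(1/log x)` pace as the PROVED case `(X)` (whose own ratios are 1.26 → 1.13 at −0.25 and
.94 → .97 at 1.5+.2i over the range). (2) The cancellation the crux needs is VISIBLE: at `0.3i`, `k = 3` the majorant grows
×1.50 while `|H|` falls ×0.82 (predicted exchange rate `(log x)^{0.9}`: ×1.65); at `−0.25`, `k = 3`: majorant ×2.0, `|H|`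
bounded ≈ .05. (3) For `k = 3` at `Re z < 0` the data sit on the NOISE FLOOR `x^{−1/2}(log x)^{k(1−Re z+(|z|²−1)/2)}`
(≈ 0.1 at 10⁷ for z = −0.25): numerics below 10⁹ cannot probe the left strip for `k ≥ 3` — ideators' falsifiers there
are void. (4) `pv` stays bounded and small on `V` for every system (renewal card's `C⁺` not contradicted); the drift of
`pv`, `E−kzL` at `1.7+.2i` for tuples is the slow approach to the large constant `z c'/c ≈ 5` forced by the `p = 2` pole.
(5) Outside `V` but inside the disc the law still holds numerically (`z = i`: saving `(log x)^k` realised; `z = −1`: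
`H → 0` as `1/Γ(−1) = 0` predicts, i.e. `Σ_{n≤x} λ(n²+1) = o(x/(log x)²)` numerically) — consistent with the disc
`|z| < 2`, not the thin rectangle, being the natural domain (cf. § Natural boundary).

## Landing status (all `--supports stmt-Parity-9769`, under `Theorems/NormalFamilyBound/Negative/`)
* `RealAxis.lean` — ACCEPTED p73132: vocabulary `V`, `Ωf`, `H`, `locallyBoundedSystems`, reduction, real-axis
  norm, witnesses, `k = 0` instance;
* `LoadBearing.lean` — ACCEPTED p74583: the five `_false_without_` theorems + `normalFamilyBoundRadius_false`;
* `NaturalBoundary.lean` — ACCEPTED p74892: the jump lemma and the sharp `R ≥ 2` / `R' ≥ 2` / tall refutations;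
* (c2) `Uniformity.lean` — ACCEPTED p75839: `isBatemanHornSystem_fXadd`, `normalFamilyBound_not_uniform_in_f`,
  `not_normalFamilyBound_uniform`, `norm_H_le_Habs`, `Habs_unbounded`, `exists_mem_V_norm_eq_one`,
  `Habs_not_locallyBoundedOn`, `not_normalFamilyBound_abs`, `card_primeTuples_le_of_mem_locallyBoundedSystems`;
* (c2) `Calibration.lean` — ACCEPTED p76248: `sum_fX_eq`, `norm_G_le`, `norm_H_fX_le_of_le_two`,
  `norm_H_fX_le_of_three_le`, `fX_mem_locallyBoundedSystems_of_MV`;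
* (c2) `Shape.lean` — ACCEPTED p78238: `mem_locallyBoundedSystems_of_uniform`, `uniform_of_locallyBoundedOn`,
  `uniform_on_closedRectangle_of_normalFamilyBound`.

Ideators / planners may `import Summits.Parity.BatemanHorn.Theorems.NormalFamilyBound.Negative.Calibration` (and
`.Uniformity`, `.LoadBearing`, `.NaturalBoundary`) rather than this work file.
-/

namespace Summit.Parity.BatemanHorn.Cruxes.NormalFamilyBound.Disproof

open Literature.NumberTheory.Sieve Polynomial Finset Filter
open Summit.Parity.BatemanHorn.Theses.SelbergDelangeRigidity
open Literature.NumberTheory.LFunctions (selbergDelangeOmegaF MontgomeryVaughan2007_thm_7_18_Omega)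

noncomputable section

/-! ## The objects of the crux, named -/

/-- The thin rectangle `V_{R,η} = {−η < Re z < R, |Im z| < η}`; the crux uses `R = 7/4`. -/
def V (R η : ℝ) : Set ℂ := {z : ℂ | -η < z.re ∧ z.re < R ∧ |z.im| < η}

/-- `Ω_f(n) = Σ_i Ω((f_i(n)).toNat)` exactly as in the crux (junk conventions: `toNat` of a negative
value is `0`, `Ω 0 = Ω 1 = 0`). -/
def Ωf {k : ℕ} (f : Fin k → ℤ[X]) (n : ℕ) : ℕ :=
  ∑ i, ArithmeticFunction.cardFactors (((f i).eval (n : ℤ)).toNat)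

/-- The normalised family `H_x(z) = x⁻¹ (log x)^{k(1−z)} Σ_{n ≤ x} z^{Ω_f(n)}` exactly as in the crux. -/
def H (k : ℕ) (f : Fin k → ℤ[X]) (x : ℕ) (z : ℂ) : ℂ :=
  (x : ℂ)⁻¹ * Complex.exp ((k : ℂ) * (1 - z) * (Real.log (Real.log x) : ℂ)) *
    ∑ n ∈ Finset.range (x + 1), z ^ (∑ i, ArithmeticFunction.cardFactors (((f i).eval (n : ℤ)).toNat))

/-- Local boundedness of `{H_x}_x` on `V_{R,η}` for some `η ∈ (0, 1/4]`, ball form (the crux: `R = 7/4`). -/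
def LocallyBounded (R : ℝ) (k : ℕ) (f : Fin k → ℤ[X]) : Prop :=
  ∃ η : ℝ, 0 < η ∧ η ≤ 1 / 4 ∧ ∀ a ∈ V R η, ∃ M : ℝ, ∃ r > (0 : ℝ), ∀ x : ℕ,
    ∀ z ∈ Metric.ball a r ∩ V R η, ‖H k f x z‖ ≤ M

/-- The crux with the right end `7/4` of the rectangle replaced by a parameter `R`. -/
def NormalFamilyBoundRadius (R : ℝ) : Prop :=
  ∀ (k : ℕ) (f : Fin k → ℤ[X]), IsBatemanHornSystem f → LocallyBounded R k f

/-- The crux, unfolded (definitional). -/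
theorem normalFamilyBound_iff :
    NormalFamilyBound ↔ ∀ (k : ℕ) (f : Fin k → ℤ[X]), IsBatemanHornSystem f → LocallyBounded (7 / 4) k f :=
  Iff.rfl

/-- The crux is the `R = 7/4` instance of `NormalFamilyBoundRadius` (definitional). -/
theorem normalFamilyBoundRadius_iff : NormalFamilyBoundRadius (7 / 4) ↔ NormalFamilyBound := Iff.rfl

/-- Local boundedness on a FIXED rectangle `V_{R,η}` (no existential over η). -/
def LocallyBoundedOn (R η : ℝ) (k : ℕ) (f : Fin k → ℤ[X]) : Prop :=
  ∀ a ∈ V R η, ∃ M : ℝ, ∃ r > (0 : ℝ), ∀ x : ℕ, ∀ z ∈ Metric.ball a r ∩ V R η, ‖H k f x z‖ ≤ M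

theorem V_mono {R η η' : ℝ} (h : η' ≤ η) : V R η' ⊆ V R η := by
  rintro z ⟨h1, h2, h3⟩
  exact ⟨by linarith, h2, by linarith⟩

/-- Local boundedness is ANTITONE in η (smaller rectangles are easier). -/
theorem LocallyBoundedOn.anti {R η η' : ℝ} {k : ℕ} {f : Fin k → ℤ[X]} (h : η' ≤ η)
    (hB : LocallyBoundedOn R η k f) : LocallyBoundedOn R η' k f := by
  intro a ha
  obtain ⟨M, r, hr, hM⟩ := hB a (V_mono h ha)
  exact ⟨M, r, hr, fun x z hz => hM x z ⟨hz.1, V_mono h hz.2⟩⟩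

/-- THE CAP `η ≤ 1/4` IS COSMETIC: `LocallyBounded R k f ↔ ∃ η > 0, LocallyBoundedOn R η k f`.
(Information for provers/planners: the cap only serves `V_{7/4,η} ⊆ ball 0 2`, see `V_subset_ball_two`,
where the limit function `Λ` of LSDRealSegment lives; it costs nothing.) -/
theorem locallyBounded_iff_exists_pos {R : ℝ} {k : ℕ} {f : Fin k → ℤ[X]} :
    LocallyBounded R k f ↔ ∃ η : ℝ, 0 < η ∧ LocallyBoundedOn R η k f := by
  constructor
  · rintro ⟨η, hη, -, hB⟩
    exact ⟨η, hη, hB⟩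
  · rintro ⟨η, hη, hB⟩
    refine ⟨min η (1 / 4), lt_min hη (by norm_num), min_le_right _ _, ?_⟩
    exact hB.anti (min_le_left _ _)

/-- Why `7/4` and `1/4`: the crux's rectangle sits inside the disc `|z| < 2` (`(7/4)² + (1/4)² = 50/16 < 4`),
the natural domain of the `Ω`-law (pole of the `p = 2` Euler factor `Σ_v (z/2)^v` at `z = 2`; cf.
`normalFamilyBoundRadius_false`). -/
theorem V_subset_ball_two {η : ℝ} (hη : η ≤ 1 / 4) : V (7 / 4) η ⊆ Metric.ball (0 : ℂ) 2 := by
  rintro z ⟨h1, h2, h3⟩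
  rw [Metric.mem_ball, dist_zero_right]
  have hre : z.re ^ 2 ≤ (7 / 4) ^ 2 := by
    have : -(7 / 4 : ℝ) < z.re := by linarith
    nlinarith
  have him : z.im ^ 2 < (1 / 4) ^ 2 := by
    have h3' : |z.im| < 1 / 4 := lt_of_lt_of_le h3 hη
    have := abs_lt.mp h3'
    nlinarith [this.1, this.2]
  have hsq : ‖z‖ ^ 2 < 2 ^ 2 := by
    rw [Complex.sq_norm, Complex.normSq_apply]
    nlinarith
  exact lt_of_pow_lt_pow_left₀ 2 (by norm_num) hsq

/-! ## Reduction to one real point -/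

/-- REDUCTION. A real point `a ∈ [0, R)` lies in every `V_{R,η}` and in every ball about itself, so
if `x ↦ ‖H_x(a)‖` is unbounded then the family is locally bounded on NO `V_{R,η}`: this is how every
witness below is used (no complex analysis; the prover's freedom to choose η is worthless against a
real-axis blow-up). -/
theorem not_locallyBounded_of_unbounded {R : ℝ} {k : ℕ} {f : Fin k → ℤ[X]} (a : ℝ) (ha0 : 0 ≤ a)
    (ha1 : a < R) (h : ∀ M : ℝ, ∃ x : ℕ, M < ‖H k f x a‖) : ¬ LocallyBounded R k f := by
  rintro ⟨η, hη, -, hB⟩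
  have haV : (a : ℂ) ∈ V R η := by
    refine ⟨?_, ?_, ?_⟩ <;> simp <;> linarith
  obtain ⟨M, r, hr, hM⟩ := hB a haV
  obtain ⟨x, hx⟩ := h M
  have := hM x a ⟨Metric.mem_ball_self hr, haV⟩
  linarith

/-- Unboundedness from a divergent minorant along a subsequence. -/
theorem unbounded_of_tendsto {k : ℕ} {f : Fin k → ℤ[X]} {a : ℝ} (g : ℕ → ℝ) (xs : ℕ → ℕ)
    (hg : Tendsto g atTop atTop) (hle : ∀ᶠ m in atTop, g m ≤ ‖H k f (xs m) a‖) :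
    ∀ M : ℝ, ∃ x : ℕ, M < ‖H k f x a‖ := by
  intro M
  obtain ⟨m, hm⟩ := ((tendsto_atTop_mono' atTop hle hg).eventually_gt_atTop M).exists
  exact ⟨xs m, hm⟩

/-- On the real axis the family is real: `H_x(a) = x⁻¹ · exp(k(1−a)·log log x) · Σ_n a^{Ω_f(n)}`. -/
theorem H_ofReal (k : ℕ) (f : Fin k → ℤ[X]) (x : ℕ) (a : ℝ) :
    H k f x a = ((x : ℝ)⁻¹ * Real.exp (k * (1 - a) * Real.log (Real.log x)) *
      ∑ n ∈ Finset.range (x + 1), a ^ Ωf f n : ℝ) := by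
  simp only [H, Ωf]
  push_cast
  ring

/-- Norm of the family at a real point `a ≥ 0` (all terms nonnegative: no cancellation can help). -/
theorem norm_H_ofReal (k : ℕ) (f : Fin k → ℤ[X]) (x : ℕ) {a : ℝ} (ha : 0 ≤ a) :
    ‖H k f x a‖ = (x : ℝ)⁻¹ * Real.exp (k * (1 - a) * Real.log (Real.log x)) *
      ∑ n ∈ Finset.range (x + 1), a ^ Ωf f n := by
  rw [H_ofReal, Complex.norm_real, Real.norm_eq_abs, abs_of_nonneg]
  have : 0 ≤ ∑ n ∈ Finset.range (x + 1), a ^ Ωf f n := sum_nonneg fun n _ => pow_nonneg ha _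
  positivity

/-! ## Exchange rate (information for provers: the route's "dial" made exact) -/

/-- EXCHANGE RATE (the route's "dial"): leaving the positive axis costs exactly the factor
`(log x)^{k(|z| − Re z)}` against the positive-weight statistic at `|z|`. -/
theorem norm_H_le_exchange (k : ℕ) (f : Fin k → ℤ[X]) (x : ℕ) (z : ℂ) :
    ‖H k f x z‖ ≤ Real.exp (k * (‖z‖ - z.re) * Real.log (Real.log x)) * ‖H k f x (‖z‖ : ℝ)‖ := by
  rw [norm_H_ofReal _ _ _ (norm_nonneg z)]
  set L : ℝ := Real.log (Real.log x)
  simp only [H, norm_mul, norm_inv, Complex.norm_natCast, Complex.norm_exp]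
  have hre : ((k : ℂ) * (1 - z) * (L : ℂ)).re = k * (1 - z.re) * L := by
    simp [Complex.mul_re, Complex.mul_im]
  rw [hre]
  have hS : ‖∑ n ∈ range (x + 1), z ^ (∑ i, ArithmeticFunction.cardFactors (((f i).eval (n : ℤ)).toNat))‖
      ≤ ∑ n ∈ range (x + 1), ‖z‖ ^ Ωf f n := by
    refine (norm_sum_le _ _).trans (le_of_eq ?_)
    simp [Ωf, norm_pow]
  calc (x : ℝ)⁻¹ * Real.exp (k * (1 - z.re) * L) *
        ‖∑ n ∈ range (x + 1), z ^ (∑ i, ArithmeticFunction.cardFactors (((f i).eval (n : ℤ)).toNat))‖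
      ≤ (x : ℝ)⁻¹ * Real.exp (k * (1 - z.re) * L) * ∑ n ∈ range (x + 1), ‖z‖ ^ Ωf f n := by
        gcongr
    _ = Real.exp (k * (‖z‖ - z.re) * L) *
        ((x : ℝ)⁻¹ * Real.exp (k * (1 - ‖z‖) * L) * ∑ n ∈ range (x + 1), ‖z‖ ^ Ωf f n) := by
        rw [show Real.exp (k * (1 - z.re) * L) = Real.exp (k * (‖z‖ - z.re) * L) *
          Real.exp (k * (1 - ‖z‖) * L) by rw [← Real.exp_add]; ring_nf]
        ring

/-- The dial on `V_{R,η}`: `|z| − Re z < 3η` (crude; the sharp constant is `(1+√2)η`). -/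
theorem norm_sub_re_lt_of_mem_V {R η : ℝ} {z : ℂ} (hz : z ∈ V R η) : ‖z‖ - z.re < 3 * η := by
  obtain ⟨h1, _, h3⟩ := hz
  have h := Complex.norm_le_abs_re_add_abs_im z
  rcases le_or_gt 0 z.re with hre | hre
  · rw [abs_of_nonneg hre] at h
    have : 0 ≤ η := le_of_lt (lt_of_le_of_lt (abs_nonneg _) h3)
    linarith
  · rw [abs_of_neg hre] at h
    linarith

/-- `log log x → ∞` along `x ∈ ℕ`. -/
theorem tendsto_loglog : Tendsto (fun x : ℕ => Real.log (Real.log x)) atTop atTop :=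
  Real.tendsto_log_atTop.comp (Real.tendsto_log_atTop.comp tendsto_natCast_atTop_atTop)

/-- `q^m / m^s → ∞` for `q > 1`. -/
theorem tendsto_geom_div_pow {q : ℝ} (hq : 1 < q) (s : ℕ) :
    Tendsto (fun m : ℕ => q ^ m / (m : ℝ) ^ s) atTop atTop := by
  have h := (tendsto_exp_mul_div_rpow_atTop s (Real.log q) (Real.log_pos hq)).comp
    tendsto_natCast_atTop_atTop
  refine h.congr' (Eventually.of_forall fun m => ?_)
  simp only [Function.comp, Real.rpow_natCast]
  rw [mul_comm, Real.exp_nat_mul, Real.exp_log (by linarith)]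

/-- For `x = 2^m`, `log x = m log 2`. -/
theorem log_two_pow (m : ℕ) : Real.log ((2 ^ m : ℕ) : ℝ) = m * Real.log 2 := by
  push_cast
  exact Real.log_pow 2 m

theorem one_le_mul_log_two {m : ℕ} (hm : 2 ≤ m) : 1 ≤ (m : ℝ) * Real.log 2 := by
  have h2 : (2 : ℝ) ≤ m := by exact_mod_cast hm
  have := Real.log_two_gt_d9
  nlinarith

/-! ## k = 0: the empty system (sanity; TRUE) -/

/-- For the empty system `H_x(z) = (x+1)/x` (and `0` at `x = 0`), bounded by `2`: the crux holds at
`k = 0` for the trivial reason. (Positive instance; information only.) -/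
theorem locallyBounded_empty (R : ℝ) (f : Fin 0 → ℤ[X]) : LocallyBounded R 0 f := by
  refine ⟨1 / 4, by norm_num, le_rfl, fun a _ => ⟨2, 1, one_pos, fun x z _ => ?_⟩⟩
  have hH : H 0 f x z = (x : ℂ)⁻¹ * (x + 1 : ℕ) := by
    simp [H]
  rw [hH, norm_mul, norm_inv, Complex.norm_natCast, Complex.norm_natCast]
  rcases Nat.eq_zero_or_pos x with rfl | hx
  · simp
  · have hx' : (0 : ℝ) < x := by exact_mod_cast hx
    rw [inv_mul_le_iff₀ hx']
    push_cast
    have : (1 : ℝ) ≤ x := by exact_mod_cast hx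
    linarith

/-! ## Load-bearing analysis: each field of `IsBatemanHornSystem` is used

For each field `F` of `IsBatemanHornSystem`, `NormalFamilyBoundWithoutF` is the crux with that field
dropped, and `normalFamilyBound_false_without_F` exhibits a system satisfying the other three fields
for which the family blows up at a REAL point of `[0, 7/4)`. -/

/-- The crux without `irreducible`. -/
def NormalFamilyBoundWithoutIrreducible : Prop :=
  ∀ (k : ℕ) (f : Fin k → ℤ[X]), (∀ i, 0 < (f i).leadingCoeff) →
    (Pairwise fun i j ↦ ¬Associated (f i) (f j)) → HasNoFixedPrimeDivisor f → LocallyBounded (7 / 4) k f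

/-- The crux without `leadingCoeff_pos`. -/
def NormalFamilyBoundWithoutLeadingCoeffPos : Prop :=
  ∀ (k : ℕ) (f : Fin k → ℤ[X]), (∀ i, Irreducible (f i)) →
    (Pairwise fun i j ↦ ¬Associated (f i) (f j)) → HasNoFixedPrimeDivisor f → LocallyBounded (7 / 4) k f

/-- The crux without `pairwise_not_associated`. -/
def NormalFamilyBoundWithoutPairwiseNotAssociated : Prop :=
  ∀ (k : ℕ) (f : Fin k → ℤ[X]), (∀ i, Irreducible (f i)) → (∀ i, 0 < (f i).leadingCoeff) →
    HasNoFixedPrimeDivisor f → LocallyBounded (7 / 4) k f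

/-- The crux without `hasNoFixedPrimeDivisor`. -/
def NormalFamilyBoundWithoutNoFixedPrimeDivisor : Prop :=
  ∀ (k : ℕ) (f : Fin k → ℤ[X]), (∀ i, Irreducible (f i)) → (∀ i, 0 < (f i).leadingCoeff) →
    (Pairwise fun i j ↦ ¬Associated (f i) (f j)) → LocallyBounded (7 / 4) k f

/-! ### Witness systems -/

/-- `(1)`: the constant unit polynomial (not irreducible). -/
def fOne : Fin 1 → ℤ[X] := ![C 1]
/-- `(X²)`: non-constant, reducible. -/
def fXsq : Fin 1 → ℤ[X] := ![X ^ 2]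
/-- `(−X)`: irreducible with negative leading coefficient. -/
def fNegX : Fin 1 → ℤ[X] := ![-X]
/-- `(2)`: the prime constant, irreducible in `ℤ[X]`, fixed prime divisor `2`. -/
def fTwo : Fin 1 → ℤ[X] := ![C 2]
/-- `(X, X)`: two associated components. -/
def fXX : Fin 2 → ℤ[X] := ![X, X]
/-- `(X)`: the integers themselves — a genuine Bateman–Horn system (the known case of the crux). -/
def fX : Fin 1 → ℤ[X] := ![X]

theorem Ωf_fOne (n : ℕ) : Ωf fOne n = 0 := by simp [Ωf, fOne]
theorem Ωf_fNegX (n : ℕ) : Ωf fNegX n = 0 := by simp [Ωf, fNegX]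
theorem Ωf_fTwo (n : ℕ) : Ωf fTwo n = 1 := by
  simp [Ωf, fTwo, ArithmeticFunction.cardFactors_apply_prime Nat.prime_two]
theorem Ωf_fXX (n : ℕ) : Ωf fXX n = 2 * ArithmeticFunction.cardFactors n := by
  simp [Ωf, fXX, Fin.sum_univ_two]; ring
theorem Ωf_fXsq (n : ℕ) : Ωf fXsq n = 2 * ArithmeticFunction.cardFactors n := by
  simp [Ωf, fXsq]
  rw [show ((n : ℤ) ^ 2).toNat = n ^ 2 by exact_mod_cast Int.toNat_natCast (n ^ 2)]
  rw [ArithmeticFunction.cardFactors_pow]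
theorem Ωf_fX (n : ℕ) : Ωf fX n = ArithmeticFunction.cardFactors n := by simp [Ωf, fX]

/-- `ω_{(X)}(p) = 1`: only `n ≡ 0`. -/
theorem card_filter_dvd_range {p : ℕ} (hp : p.Prime) :
    #((range p).filter fun n : ℕ ↦ (p : ℤ) ∣ (n : ℤ)) = 1 := by
  rw [show (range p).filter (fun n : ℕ ↦ (p : ℤ) ∣ (n : ℤ)) = {0} from ?_]
  · simp
  ext n
  simp only [mem_filter, mem_range, mem_singleton, Int.natCast_dvd_natCast]
  constructor
  · rintro ⟨hn, hdvd⟩; exact Nat.eq_zero_of_dvd_of_lt hdvd hn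
  · rintro rfl; exact ⟨hp.pos, dvd_zero p⟩

theorem hasNoFixedPrimeDivisor_fX : HasNoFixedPrimeDivisor fX := fun p hp => by
  simp only [polyRootCountMod, fX, Fin.prod_univ_one, Matrix.cons_val_fin_one, eval_X]
  rw [card_filter_dvd_range hp]; exact hp.one_lt

theorem hasNoFixedPrimeDivisor_fNegX : HasNoFixedPrimeDivisor fNegX := fun p hp => by
  simp only [polyRootCountMod, fNegX, Fin.prod_univ_one, Matrix.cons_val_fin_one, eval_neg, eval_X,
    dvd_neg]
  rw [card_filter_dvd_range hp]; exact hp.one_lt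

theorem hasNoFixedPrimeDivisor_fOne : HasNoFixedPrimeDivisor fOne := fun p hp => by
  simp only [polyRootCountMod, fOne, Fin.prod_univ_one, Matrix.cons_val_fin_one, eval_C]
  rw [Finset.filter_false_of_mem]
  · simp [hp.pos]
  · intro n _ h
    have := Int.eq_one_of_dvd_one (by positivity) h
    have := hp.one_lt
    omega

theorem sq_filter_eq {p : ℕ} (hp : p.Prime) :
    (range p).filter (fun n : ℕ ↦ (p : ℤ) ∣ (n : ℤ) * (n : ℤ)) =
      (range p).filter fun n : ℕ ↦ (p : ℤ) ∣ (n : ℤ) := by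
  have hpZ : Prime (p : ℤ) := Nat.prime_iff_prime_int.mp hp
  ext n
  simp only [mem_filter, and_congr_right_iff]
  intro _
  constructor
  · intro h; rcases hpZ.dvd_or_dvd h with h | h <;> exact h
  · intro h; exact dvd_mul_of_dvd_left h _

theorem hasNoFixedPrimeDivisor_fXX : HasNoFixedPrimeDivisor fXX := fun p hp => by
  simp only [polyRootCountMod, fXX, Fin.prod_univ_two, Matrix.cons_val_zero, Matrix.cons_val_one,
    eval_X]
  rw [sq_filter_eq hp, card_filter_dvd_range hp]; exact hp.one_lt

theorem hasNoFixedPrimeDivisor_fXsq : HasNoFixedPrimeDivisor fXsq := fun p hp => by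
  simp only [polyRootCountMod, fXsq, Fin.prod_univ_one, Matrix.cons_val_fin_one, eval_pow, eval_X]
  simp only [sq]
  rw [sq_filter_eq hp, card_filter_dvd_range hp]; exact hp.one_lt

/-- `(X)` IS a Bateman–Horn system. -/
theorem isBatemanHornSystem_fX : IsBatemanHornSystem fX where
  irreducible i := by fin_cases i; simpa [fX] using irreducible_X
  leadingCoeff_pos i := by fin_cases i; simp [fX]
  pairwise_not_associated := Subsingleton.pairwise
  hasNoFixedPrimeDivisor := hasNoFixedPrimeDivisor_fX

/-! ### The blow-ups -/

/-- At `z = 0` with `Ω_f ≡ 0`: `‖H_x(0)‖ = (x+1)/x · exp(k · log log x) ≥ exp(k log log x)`. -/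
theorem norm_H_at_zero_of_Ωf_zero {k : ℕ} {f : Fin k → ℤ[X]} (hΩ : ∀ n, Ωf f n = 0) (x : ℕ)
    (hx : 1 ≤ x) : Real.exp (k * Real.log (Real.log x)) ≤ ‖H k f x (0 : ℝ)‖ := by
  rw [norm_H_ofReal _ _ _ le_rfl]
  simp only [hΩ, pow_zero, sum_const, card_range, nsmul_eq_mul, mul_one, sub_zero]
  have hx' : (0 : ℝ) < x := by exact_mod_cast hx
  rw [mul_comm ((x : ℝ)⁻¹), mul_assoc]
  refine le_mul_of_one_le_right (Real.exp_nonneg _) ?_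
  rw [le_inv_mul_iff₀ hx']; push_cast; linarith

theorem unbounded_at_zero_of_Ωf_zero {k : ℕ} (hk : 1 ≤ k) {f : Fin k → ℤ[X]} (hΩ : ∀ n, Ωf f n = 0) :
    ∀ M : ℝ, ∃ x : ℕ, M < ‖H k f x (0 : ℝ)‖ := by
  refine unbounded_of_tendsto (fun x : ℕ => Real.exp (k * Real.log (Real.log x))) id ?_ ?_
  · exact Real.tendsto_exp_atTop.comp (tendsto_loglog.const_mul_atTop (by exact_mod_cast hk))
  · filter_upwards [eventually_ge_atTop 1] with x hx using norm_H_at_zero_of_Ωf_zero hΩ x hx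

/-- LOAD-BEARING `irreducible` (constant witness): for `f = (1)` one has `Ω_f ≡ 0`, so
`H_x(0) = (x+1) x⁻¹ log x → ∞` at the point `0 ∈ V_η`. Any proof must use that the `f_i` are
non-units. -/
theorem normalFamilyBound_false_without_irreducible : ¬ NormalFamilyBoundWithoutIrreducible := by
  intro h
  refine not_locallyBounded_of_unbounded 0 le_rfl (by norm_num)
    (unbounded_at_zero_of_Ωf_zero le_rfl Ωf_fOne) (h 1 fOne ?_ (Subsingleton.pairwise)
      hasNoFixedPrimeDivisor_fOne)
  intro i; fin_cases i; simp [fOne]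

/-- LOAD-BEARING `leadingCoeff_pos`: for `f = (−X)` every value is `≤ 0`, `toNat` makes it `0` and
`Ω 0 = 0`, so again `Ω_f ≡ 0` and `H_x(0) → ∞`. (The blow-up exploits the `toNat` junk convention;
with `|f_i(n)|` in place of `toNat` the system `(−X)` would behave like `(X)`. So this field is used,
but only through the sign convention.) -/
theorem normalFamilyBound_false_without_leadingCoeffPos :
    ¬ NormalFamilyBoundWithoutLeadingCoeffPos := by
  intro h
  refine not_locallyBounded_of_unbounded 0 le_rfl (by norm_num)
    (unbounded_at_zero_of_Ωf_zero le_rfl Ωf_fNegX) (h 1 fNegX ?_ (Subsingleton.pairwise)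
      hasNoFixedPrimeDivisor_fNegX)
  intro i; fin_cases i
  simpa [fNegX] using (Associated.refl (X : ℤ[X])).neg_right.irreducible irreducible_X

/-- At `z = 1/2` with `Ω_f ≡ 1`: `‖H_x(1/2)‖ = (x+1)/(2x) · exp(k/2 · log log x)`. -/
theorem norm_H_at_half_of_Ωf_one {k : ℕ} {f : Fin k → ℤ[X]} (hΩ : ∀ n, Ωf f n = 1) (x : ℕ)
    (hx : 1 ≤ x) : Real.exp (k * (1 / 2) * Real.log (Real.log x)) / 2 ≤ ‖H k f x (1 / 2 : ℝ)‖ := by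
  rw [norm_H_ofReal _ _ _ (by norm_num)]
  simp only [hΩ, pow_one, sum_const, card_range, nsmul_eq_mul]
  have hx' : (0 : ℝ) < x := by exact_mod_cast hx
  have hx1 : (1 : ℝ) ≤ x := by exact_mod_cast hx
  rw [show (1 : ℝ) - 1 / 2 = 1 / 2 by norm_num]
  rw [show (x : ℝ)⁻¹ * Real.exp (k * (1 / 2) * Real.log (Real.log x)) * (((x + 1 : ℕ) : ℝ) * (1 / 2))
      = Real.exp (k * (1 / 2) * Real.log (Real.log x)) / 2 * ((x : ℝ)⁻¹ * ((x + 1 : ℕ) : ℝ)) by ring]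
  refine le_mul_of_one_le_right (by positivity) ?_
  rw [le_inv_mul_iff₀ hx']; push_cast; linarith

/-- LOAD-BEARING `hasNoFixedPrimeDivisor` (constant witness): `f = (2)` is irreducible in `ℤ[X]`
with positive leading coefficient, `Ω_f ≡ 1`, and `H_x(1/2) = (x+1)/(2x) (log x)^{1/2} → ∞`.
NOTE for provers: this only shows the field is used to exclude CONSTANTS. For a NON-constant system
with a fixed prime divisor (e.g. `X² + X + 2`, always even) the family is plausibly still locally
bounded (a fixed prime shifts `Ω_f` by a bounded amount in mean, changing constants, not orders):
for non-constant systems `hasNoFixedPrimeDivisor` is possibly unnecessary for THIS crux (it is of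
course essential for Bateman–Horn itself, via `C(f) > 0`). -/
theorem normalFamilyBound_false_without_noFixedPrimeDivisor :
    ¬ NormalFamilyBoundWithoutNoFixedPrimeDivisor := by
  intro h
  have hB := h 1 fTwo ?_ ?_ (Subsingleton.pairwise)
  · refine not_locallyBounded_of_unbounded (1 / 2) (by norm_num) (by norm_num) ?_ hB
    refine unbounded_of_tendsto (fun x : ℕ => Real.exp ((1 : ℕ) * (1 / 2) * Real.log (Real.log x)) / 2)
      id ?_ ?_
    · refine Tendsto.atTop_div_const (by norm_num) ?_
      exact Real.tendsto_exp_atTop.comp (tendsto_loglog.const_mul_atTop (by norm_num))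
    · filter_upwards [eventually_ge_atTop 1] with x hx using norm_H_at_half_of_Ωf_one Ωf_fTwo x hx
  · intro i; fin_cases i
    simpa [fTwo] using (Polynomial.prime_C_iff.mpr Int.prime_two).irreducible
  · intro i; fin_cases i
    simp only [fTwo, Matrix.cons_val_fin_one, leadingCoeff_C]
    norm_num

/-- The `2^m` mechanism (triager r1-1's finding F1, formalised): if `Ω_f(2^m) ≥ c·m`... we only need
the two concrete instances below, stated via a common estimate: at the real point `a = 3/2` and
`x = 2^m`, a single term `n = 2^m` with `Ω_f(n) = 2m` already gives
`‖H_x(3/2)‖ ≥ 2^{−m} · (log x)^{−k/2} · (9/4)^m ≥ (9/8)^m / (m log 2)` (for `k ≤ 2`, `m ≥ 2`). -/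
theorem norm_H_three_halves_ge {k : ℕ} (hk : k ≤ 2) {f : Fin k → ℤ[X]}
    (hΩ : ∀ n, Ωf f n = 2 * ArithmeticFunction.cardFactors n) (m : ℕ) (hm : 2 ≤ m) :
    (9 / 8 : ℝ) ^ m / (m * Real.log 2) ≤ ‖H k f (2 ^ m) (3 / 2 : ℝ)‖ := by
  rw [norm_H_ofReal _ _ _ (by norm_num), log_two_pow]
  have hL1 : 1 ≤ (m : ℝ) * Real.log 2 := one_le_mul_log_two hm
  have hL0 : 0 < (m : ℝ) * Real.log 2 := by linarith
  have hlog0 : 0 ≤ Real.log ((m : ℝ) * Real.log 2) := Real.log_nonneg hL1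
  -- the exponential factor is at least exp(-log(m log 2)) = (m log 2)⁻¹
  have hexp : ((m : ℝ) * Real.log 2)⁻¹ ≤ Real.exp (k * (1 - (3 / 2 : ℝ)) * Real.log (m * Real.log 2)) := by
    have : ((m : ℝ) * Real.log 2)⁻¹ = Real.exp (-Real.log (m * Real.log 2)) := by
      rw [Real.exp_neg, Real.exp_log hL0]
    rw [this]
    refine Real.exp_le_exp.mpr ?_
    have hk' : (k : ℝ) ≤ 2 := by exact_mod_cast hk
    nlinarith
  -- the sum is at least its term n = 2^m
  have hterm : (3 / 2 : ℝ) ^ Ωf f (2 ^ m) ≤ ∑ n ∈ range (2 ^ m + 1), (3 / 2 : ℝ) ^ Ωf f n :=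
    single_le_sum (f := fun n => (3 / 2 : ℝ) ^ Ωf f n) (fun n _ => by positivity) (by simp)
  rw [hΩ, ArithmeticFunction.cardFactors_apply_prime_pow Nat.prime_two, pow_mul] at hterm
  norm_num at hterm
  calc (9 / 8 : ℝ) ^ m / (m * Real.log 2)
      = ((2 ^ m : ℕ) : ℝ)⁻¹ * ((m : ℝ) * Real.log 2)⁻¹ * (9 / 4 : ℝ) ^ m := by
        push_cast
        rw [div_eq_mul_inv, show (9 / 8 : ℝ) ^ m = ((2 : ℝ) ^ m)⁻¹ * (9 / 4) ^ m by
          rw [← inv_pow, ← mul_pow]; norm_num]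
        ring
    _ ≤ _ := by gcongr

theorem unbounded_three_halves {k : ℕ} (hk : k ≤ 2) {f : Fin k → ℤ[X]}
    (hΩ : ∀ n, Ωf f n = 2 * ArithmeticFunction.cardFactors n) :
    ∀ M : ℝ, ∃ x : ℕ, M < ‖H k f x (3 / 2 : ℝ)‖ := by
  refine unbounded_of_tendsto (fun m : ℕ => (9 / 8 : ℝ) ^ m / (m * Real.log 2)) (fun m => 2 ^ m)
    ?_ ?_
  · have h := (tendsto_geom_div_pow (by norm_num : (1 : ℝ) < 9 / 8) 1).atTop_div_const
      (Real.log_pos one_lt_two)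
    refine h.congr' (Eventually.of_forall fun m => ?_)
    simp only [pow_one]; ring
  · filter_upwards [eventually_ge_atTop 2] with m hm using norm_H_three_halves_ge hk hΩ m hm

/-- LOAD-BEARING `pairwise_not_associated`: for `f = (X, X)` (irreducible, monic, `ω(p) = 1 < p`)
`Ω_f(n) = 2Ω(n)` and the single term `n = 2^m ≤ x = 2^m` gives `‖H_x(3/2)‖ ≥ (9/8)^m/(m log 2) → ∞`
at the REAL point `3/2 ∈ (5/4, 7/4)` — inside the segment where LSDRealSegment lives. Mechanism:
repeating a component squares the weight, `(3/2)² = 9/4 > 2` crosses the `p = 2` radius. -/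
theorem normalFamilyBound_false_without_pairwiseNotAssociated :
    ¬ NormalFamilyBoundWithoutPairwiseNotAssociated := by
  intro h
  refine not_locallyBounded_of_unbounded (3 / 2) (by norm_num) (by norm_num)
    (unbounded_three_halves le_rfl Ωf_fXX) (h 2 fXX ?_ ?_ hasNoFixedPrimeDivisor_fXX)
  · intro i; fin_cases i <;> simpa [fXX] using irreducible_X
  · intro i; fin_cases i <;> simp [fXX]

/-- LOAD-BEARING `irreducible` (non-constant witness): `f = (X²)` is monic with `ω(p) = 1`, but
`Ω(n²) = 2Ω(n)` and the same `2^m` term blows up at `a = 3/2`. So irreducibility is used beyond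
excluding constants: a square factor doubles the weight exponent. -/
theorem normalFamilyBound_false_without_irreducible' : ¬ NormalFamilyBoundWithoutIrreducible := by
  intro h
  refine not_locallyBounded_of_unbounded (3 / 2) (by norm_num) (by norm_num)
    (unbounded_three_halves (by norm_num) Ωf_fXsq) (h 1 fXsq ?_ (Subsingleton.pairwise)
      hasNoFixedPrimeDivisor_fXsq)
  intro i; fin_cases i; simp [fXsq]

/-! ## Tightness of the right end: `7/4` cannot become any `R > 2`

(Triager r1-1's F1 for the GENUINE Bateman–Horn system `f = (X)`; Montgomery–Vaughan Thm 7.18: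
"the restriction `R < 2` is necessary".) For real `y ∈ (2, R)`, the single term `n = 2^m` gives
`‖H_{2^m}(y)‖ ≥ (y/2)^m (m log 2)^{1−y} → ∞`. So the statement is false for every `R > 2`, and
the crux's `V_η ⊂ {|z| < 2}` (as `(7/4)² + (1/4)² < 4`) is essentially the maximal safe region. -/
theorem norm_H_fX_ge {y : ℝ} (hy2 : 2 < y) (hy3 : y ≤ 3) (m : ℕ) (hm : 2 ≤ m) :
    (y / 2) ^ m / ((m : ℝ) * Real.log 2) ^ 2 ≤ ‖H 1 fX (2 ^ m) y‖ := by
  rw [norm_H_ofReal _ _ _ (by linarith), log_two_pow]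
  have hL1 : 1 ≤ (m : ℝ) * Real.log 2 := one_le_mul_log_two hm
  have hL0 : 0 < (m : ℝ) * Real.log 2 := by linarith
  have hlog0 : 0 ≤ Real.log ((m : ℝ) * Real.log 2) := Real.log_nonneg hL1
  have hexp : (((m : ℝ) * Real.log 2) ^ 2)⁻¹ ≤
      Real.exp ((1 : ℕ) * (1 - y) * Real.log (m * Real.log 2)) := by
    rw [← Real.exp_log (by positivity : (0 : ℝ) < ((m : ℝ) * Real.log 2) ^ 2), ← Real.exp_neg,
      Real.log_pow]
    refine Real.exp_le_exp.mpr ?_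
    push_cast
    nlinarith
  have hterm : y ^ Ωf fX (2 ^ m) ≤ ∑ n ∈ range (2 ^ m + 1), y ^ Ωf fX n :=
    single_le_sum (f := fun n => y ^ Ωf fX n) (fun n _ => by positivity) (by simp)
  rw [Ωf_fX, ArithmeticFunction.cardFactors_apply_prime_pow Nat.prime_two] at hterm
  calc (y / 2) ^ m / ((m : ℝ) * Real.log 2) ^ 2
      = ((2 ^ m : ℕ) : ℝ)⁻¹ * (((m : ℝ) * Real.log 2) ^ 2)⁻¹ * y ^ m := by
        push_cast
        rw [div_pow, div_eq_mul_inv]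
        ring
    _ ≤ _ := by gcongr

theorem normalFamilyBoundRadius_false {R : ℝ} (hR : 2 < R) : ¬ NormalFamilyBoundRadius R := by
  intro h
  -- a real point y with 2 < y < R, y ≤ 3
  set y : ℝ := min ((2 + R) / 2) 3 with hy
  have hy2 : 2 < y := by rw [hy]; exact lt_min (by linarith) (by norm_num)
  have hyR : y < R := by rw [hy]; exact min_lt_of_left_lt (by linarith)
  have hy3 : y ≤ 3 := min_le_right _ _
  refine not_locallyBounded_of_unbounded y (by linarith) hyR ?_ (h 1 fX isBatemanHornSystem_fX)
  refine unbounded_of_tendsto (fun m : ℕ => (y / 2) ^ m / ((m : ℝ) * Real.log 2) ^ 2)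
    (fun m => 2 ^ m) ?_ ?_
  · have h := (tendsto_geom_div_pow (by linarith : (1 : ℝ) < y / 2) 2).atTop_div_const
      (by positivity : (0 : ℝ) < Real.log 2 ^ 2)
    refine h.congr' (Eventually.of_forall fun m => ?_)
    simp only [mul_pow]; ring
  · filter_upwards [eventually_ge_atTop 2] with m hm using norm_H_fX_ge hy2 hy3 m hm

/-! ## Natural boundary `|z| = 2` for `f = (X)` in EVERY direction (the jump at `n = 2^m`)

For ANY complex `z`, consecutive sums differ by `S_{2^m}(z) − S_{2^m−1}(z) = z^{Ω(2^m)} = z^m`, so one of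
`‖H_{2^m−1}(z)‖, ‖H_{2^m}(z)‖` is `≥ (‖z‖/2)^m / (2(m log 2)^N)` — unbounded as soon as `‖z‖ > 2`, with no
lower-bound technology at all. Hence the family of the genuine BH system `(X)` is locally bounded on NO set
containing a point of modulus `> 2`. SHARP consequences for the shape of the crux: a thin rectangle
`{−η < Re z < R, |Im z| < η}` pokes out of the disc as soon as `R ≥ 2` (at `(2 − η²/32) + iη/2`), so
`7/4 ↦ 2` already fails (`normalFamilyBoundRadius_false_of_two_le`), and symmetrically `−η ↦ −R'` fails for
every `R' ≥ 2` (`normalFamilyBoundLeft_false_of_two_le`); a fixed height `> 1` fails near `Re z = 7/4`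
(`normalFamilyBoundTall_false`). Inside the disc, for `(X)`, everything holds (MV Thm 7.18, `|z| ≤ R < 2`).
So: right end `R` must be `< 2` (the route's 7/4 ✓), left end `> −2` (the route's −η ✓), height small ✓. -/

/-- The size of the normalising exponential at ANY complex `z`, for `3 ≤ x ≤ 2^m`:
`‖exp(k(1−z) log log x)‖ ≥ (m log 2)^{−N}` whenever `k|1 − Re z| ≤ N`. -/
theorem norm_exp_normaliser_ge (k : ℕ) (z : ℂ) {m x N : ℕ} (hm : 2 ≤ m) (hx3 : 3 ≤ x)
    (hxle : x ≤ 2 ^ m) (hN : k * |1 - z.re| ≤ N) :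
    (((m : ℝ) * Real.log 2) ^ N)⁻¹ ≤
      ‖Complex.exp ((k : ℂ) * (1 - z) * (Real.log (Real.log x) : ℂ))‖ := by
  set L : ℝ := Real.log (Real.log x) with hL
  have hre : ((k : ℂ) * (1 - z) * (L : ℂ)).re = k * (1 - z.re) * L := by
    simp [Complex.mul_re, Complex.mul_im]
  rw [Complex.norm_exp, hre]
  have hx3' : (3 : ℝ) ≤ x := by exact_mod_cast hx3
  have hlog3 : (1 : ℝ) < Real.log 3 := by
    rw [Real.lt_log_iff_exp_lt (by norm_num)]
    have := Real.exp_one_lt_d9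
    linarith
  have hlogx : 1 < Real.log x := hlog3.trans_le (Real.log_le_log (by norm_num) hx3')
  have hL0 : 0 ≤ L := Real.log_nonneg hlogx.le
  have ht1 : 1 ≤ (m : ℝ) * Real.log 2 := one_le_mul_log_two hm
  have hlog2m : Real.log x ≤ m * Real.log 2 := by
    have : (x : ℝ) ≤ (2 : ℝ) ^ m := by exact_mod_cast hxle
    calc Real.log x ≤ Real.log ((2 : ℝ) ^ m) := Real.log_le_log (by linarith) this
      _ = m * Real.log 2 := Real.log_pow 2 m
  have hL1 : L ≤ Real.log (m * Real.log 2) := Real.log_le_log (by linarith) hlog2m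
  -- exponent ≥ -N * log (m log 2)
  have hexp : -(N * Real.log (m * Real.log 2)) ≤ k * (1 - z.re) * L := by
    have h1 : -(k * |1 - z.re| * L) ≤ k * (1 - z.re) * L := by
      have := neg_abs_le (1 - z.re)
      have hk : (0 : ℝ) ≤ k := by positivity
      nlinarith [mul_nonneg hk hL0]
    have h2 : k * |1 - z.re| * L ≤ N * Real.log (m * Real.log 2) := by
      have hlog0 : 0 ≤ Real.log (m * Real.log 2) := Real.log_nonneg ht1
      calc k * |1 - z.re| * L ≤ N * L := by gcongr
        _ ≤ N * Real.log (m * Real.log 2) := by gcongr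
    linarith
  calc (((m : ℝ) * Real.log 2) ^ N)⁻¹ = Real.exp (-(N * Real.log (m * Real.log 2))) := by
        rw [Real.exp_neg, Real.exp_nat_mul, Real.exp_log (by linarith)]
    _ ≤ _ := Real.exp_le_exp.mpr hexp

/-- THE JUMP AT `n = 2^m`: for `f = (X)` and ANY complex `z`, the two consecutive sums `S_{2^m−1}(z)`,
`S_{2^m}(z)` differ by `z^{Ω(2^m)} = z^m`, so one of `‖H_{2^m−1}(z)‖`, `‖H_{2^m}(z)‖` is at least
`(‖z‖/2)^m / (2 (m log 2)^N)` (`N ≥ k|1 − Re z|`). -/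
theorem exists_norm_H_fX_ge (z : ℂ) {m N : ℕ} (hm : 2 ≤ m) (hN : 1 * |1 - z.re| ≤ N) :
    ∃ x ∈ ({2 ^ m - 1, 2 ^ m} : Finset ℕ),
      (‖z‖ / 2) ^ m / (2 * ((m : ℝ) * Real.log 2) ^ N) ≤ ‖H 1 fX x z‖ := by
  -- the two sums
  set T : ℂ := ∑ n ∈ range (2 ^ m), z ^ (∑ i, ArithmeticFunction.cardFactors (((fX i).eval (n : ℤ)).toNat))
    with hT
  have h4 : 4 ≤ 2 ^ m := by
    calc 4 = 2 ^ 2 := by norm_num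
      _ ≤ 2 ^ m := Nat.pow_le_pow_right (by norm_num) hm
  have hx1 : 2 ^ m - 1 + 1 = 2 ^ m := Nat.sub_add_cancel Nat.one_le_two_pow
  have hS1 : H 1 fX (2 ^ m - 1) z = ((2 ^ m - 1 : ℕ) : ℂ)⁻¹ *
      Complex.exp (((1 : ℕ) : ℂ) * (1 - z) * (Real.log (Real.log (2 ^ m - 1 : ℕ)) : ℂ)) * T := by
    simp only [H, hx1, hT]
  have hterm : (∑ i, ArithmeticFunction.cardFactors (((fX i).eval ((2 ^ m : ℕ) : ℤ)).toNat)) = m := by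
    have := Ωf_fX (2 ^ m)
    simp only [Ωf] at this
    rw [this, ArithmeticFunction.cardFactors_apply_prime_pow Nat.prime_two]
  have hS2 : H 1 fX (2 ^ m) z = ((2 ^ m : ℕ) : ℂ)⁻¹ *
      Complex.exp (((1 : ℕ) : ℂ) * (1 - z) * (Real.log (Real.log (2 ^ m : ℕ)) : ℂ)) * (T + z ^ m) := by
    simp only [H, Finset.sum_range_succ, hterm, hT]
  -- lower bounds for the three factors
  have hpow : (0 : ℝ) < (2 : ℝ) ^ m := by positivity
  have h4' : (4 : ℝ) ≤ (2 : ℝ) ^ m := by exact_mod_cast h4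
  have hinv1 : ((2 : ℝ) ^ m)⁻¹ ≤ ‖((2 ^ m - 1 : ℕ) : ℂ)⁻¹‖ := by
    rw [norm_inv, Complex.norm_natCast]
    refine inv_anti₀ (by rw [Nat.cast_sub Nat.one_le_two_pow]; push_cast; linarith) ?_
    rw [Nat.cast_sub Nat.one_le_two_pow]; push_cast; linarith
  have hinv2 : ((2 : ℝ) ^ m)⁻¹ ≤ ‖((2 ^ m : ℕ) : ℂ)⁻¹‖ := by
    rw [norm_inv, Complex.norm_natCast]; push_cast; exact le_rfl
  have hE1 := norm_exp_normaliser_ge 1 z hm (x := 2 ^ m - 1) (by omega) (Nat.sub_le _ _)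
    (by simpa using hN)
  have hE2 := norm_exp_normaliser_ge 1 z hm (x := 2 ^ m) (by omega) le_rfl (by simpa using hN)
  set c : ℝ := (((m : ℝ) * Real.log 2) ^ N)⁻¹ with hc
  have hc0 : 0 < c := by
    have := one_le_mul_log_two hm
    positivity
  -- triangle inequality: ‖z‖^m ≤ ‖T + z^m‖ + ‖T‖
  have htri : ‖z‖ ^ m ≤ ‖T + z ^ m‖ + ‖T‖ := by
    have := norm_sub_le (T + z ^ m) T
    simpa [norm_pow] using this
  -- combine
  have hsum : 2 * ((‖z‖ / 2) ^ m / (2 * ((m : ℝ) * Real.log 2) ^ N)) ≤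
      ‖H 1 fX (2 ^ m - 1) z‖ + ‖H 1 fX (2 ^ m) z‖ := by
    rw [hS1, hS2, norm_mul, norm_mul, norm_mul, norm_mul]
    calc 2 * ((‖z‖ / 2) ^ m / (2 * ((m : ℝ) * Real.log 2) ^ N))
        = ((2 : ℝ) ^ m)⁻¹ * c * ‖z‖ ^ m := by
          rw [hc, div_pow]; field_simp
      _ ≤ ((2 : ℝ) ^ m)⁻¹ * c * (‖T + z ^ m‖ + ‖T‖) := by gcongr
      _ = ((2 : ℝ) ^ m)⁻¹ * c * ‖T‖ + ((2 : ℝ) ^ m)⁻¹ * c * ‖T + z ^ m‖ := by ring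
      _ ≤ _ := by gcongr
  by_cases h : (‖z‖ / 2) ^ m / (2 * ((m : ℝ) * Real.log 2) ^ N) ≤ ‖H 1 fX (2 ^ m - 1) z‖
  · exact ⟨2 ^ m - 1, by simp, h⟩
  · exact ⟨2 ^ m, by simp, by linarith [not_le.mp h]⟩

/-- NATURAL BOUNDARY for `f = (X)`: at every `z` with `‖z‖ > 2` the sequence `‖H_x(z)‖` is unbounded. -/
theorem fX_unbounded_of_two_lt_norm (z : ℂ) (hz : 2 < ‖z‖) : ∀ M : ℝ, ∃ x : ℕ, M < ‖H 1 fX x z‖ := by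
  intro M
  obtain ⟨N, hN⟩ := exists_nat_ge (1 * |1 - z.re|)
  have hq : (1 : ℝ) < ‖z‖ / 2 := by linarith
  have ht : Tendsto (fun m : ℕ => (‖z‖ / 2) ^ m / (2 * ((m : ℝ) * Real.log 2) ^ N)) atTop atTop := by
    have h := (tendsto_geom_div_pow hq N).atTop_div_const
      (by positivity : (0 : ℝ) < 2 * Real.log 2 ^ N)
    refine h.congr' (Eventually.of_forall fun m => ?_)
    simp only [mul_pow]; ring
  obtain ⟨m, hm2, hmM⟩ := ((eventually_ge_atTop 2).and (ht.eventually_gt_atTop M)).exists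
  obtain ⟨x, -, hx⟩ := exists_norm_H_fX_ge z hm2 hN
  exact ⟨x, hmM.trans_le hx⟩

/-- Reduction (set form): a point `z₀ ∈ W` with `sup_x ‖H_x(z₀)‖ = ∞` kills local boundedness on `W`. -/
theorem not_locallyBoundedOn_of_unbounded {k : ℕ} {f : Fin k → ℤ[X]} {W : Set ℂ} {z₀ : ℂ}
    (hW : z₀ ∈ W) (h : ∀ M : ℝ, ∃ x : ℕ, M < ‖H k f x z₀‖) :
    ¬ ∀ a ∈ W, ∃ M : ℝ, ∃ r > (0 : ℝ), ∀ x : ℕ, ∀ z ∈ Metric.ball a r ∩ W, ‖H k f x z‖ ≤ M := by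
  intro hB
  obtain ⟨M, r, hr, hM⟩ := hB z₀ hW
  obtain ⟨x, hx⟩ := h M
  have := hM x z₀ ⟨Metric.mem_ball_self hr, hW⟩
  linarith

/-- For `f = (X)`: no set containing a point of modulus `> 2` carries a locally bounded family. -/
theorem fX_not_locallyBoundedOn {W : Set ℂ} {z₀ : ℂ} (hz : 2 < ‖z₀‖) (hW : z₀ ∈ W) :
    ¬ ∀ a ∈ W, ∃ M : ℝ, ∃ r > (0 : ℝ), ∀ x : ℕ, ∀ z ∈ Metric.ball a r ∩ W, ‖H 1 fX x z‖ ≤ M :=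
  not_locallyBoundedOn_of_unbounded hW (fX_unbounded_of_two_lt_norm z₀ hz)

/-- HEIGHT: the crux with `|Im z| < η` replaced by a fixed height `h > 1` is false
(f = (X), z₀ = 1.74 + i, `|z₀|² = 4.0276 > 4`). -/
theorem normalFamilyBoundTall_false {h : ℝ} (hh : 1 < h) :
    ¬ ∀ (k : ℕ) (f : Fin k → ℤ[X]), IsBatemanHornSystem f →
      ∃ η : ℝ, 0 < η ∧ ∀ a ∈ {z : ℂ | -η < z.re ∧ z.re < 7 / 4 ∧ |z.im| < h},
        ∃ M : ℝ, ∃ r > (0 : ℝ), ∀ x : ℕ,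
          ∀ z ∈ Metric.ball a r ∩ {z : ℂ | -η < z.re ∧ z.re < 7 / 4 ∧ |z.im| < h}, ‖H k f x z‖ ≤ M := by
  intro hyp
  obtain ⟨η, hη, hB⟩ := hyp 1 fX isBatemanHornSystem_fX
  refine fX_not_locallyBoundedOn (z₀ := ⟨174 / 100, 1⟩) ?_ ?_ hB
  · have hsq : (2 : ℝ) ^ 2 < ‖(⟨174 / 100, 1⟩ : ℂ)‖ ^ 2 := by
      rw [Complex.sq_norm, Complex.normSq_mk]; norm_num
    exact lt_of_pow_lt_pow_left₀ 2 (norm_nonneg _) hsq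
  · refine ⟨?_, ?_, ?_⟩ <;> simp <;> linarith

/-- RIGHT END, sharp: already `7/4 ↦ 2` fails — the thin rectangle `{−η < Re z < 2, |Im z| < η}` pokes out
of the disc at `z₀ = (2 − η²/32) + iη/2` (`|z₀|² = 4 + η²/8 + η⁴/1024`), whatever `η > 0` the prover picks. -/
theorem normalFamilyBoundRadius_false_of_two_le {R : ℝ} (hR : 2 ≤ R) :
    ¬ ∀ (k : ℕ) (f : Fin k → ℤ[X]), IsBatemanHornSystem f →
      ∃ η : ℝ, 0 < η ∧ η ≤ 1 / 4 ∧ ∀ a ∈ {z : ℂ | -η < z.re ∧ z.re < R ∧ |z.im| < η},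
        ∃ M : ℝ, ∃ r > (0 : ℝ), ∀ x : ℕ,
          ∀ z ∈ Metric.ball a r ∩ {z : ℂ | -η < z.re ∧ z.re < R ∧ |z.im| < η}, ‖H k f x z‖ ≤ M := by
  intro h
  obtain ⟨η, hη, hη4, hB⟩ := h 1 fX isBatemanHornSystem_fX
  refine fX_not_locallyBoundedOn (z₀ := ⟨2 - η ^ 2 / 32, η / 2⟩) ?_ ?_ hB
  · have hsq : (2 : ℝ) ^ 2 < ‖(⟨2 - η ^ 2 / 32, η / 2⟩ : ℂ)‖ ^ 2 := by
      rw [Complex.sq_norm, Complex.normSq_mk]; nlinarith [sq_nonneg η, pow_pos hη 4]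
    exact lt_of_pow_lt_pow_left₀ 2 (norm_nonneg _) hsq
  · refine ⟨?_, ?_, ?_⟩ <;> simp
    · nlinarith
    · nlinarith
    · rw [abs_of_pos (by linarith)]; linarith

/-- LEFT END, sharp: `−η ↦ −R'` fails for every `R' ≥ 2` (`z₀ = −(2 − η²/32) + iη/2`). -/
theorem normalFamilyBoundLeft_false_of_two_le {R' : ℝ} (hR' : 2 ≤ R') :
    ¬ ∀ (k : ℕ) (f : Fin k → ℤ[X]), IsBatemanHornSystem f →
      ∃ η : ℝ, 0 < η ∧ η ≤ 1 / 4 ∧ ∀ a ∈ {z : ℂ | -R' < z.re ∧ z.re < 7 / 4 ∧ |z.im| < η},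
        ∃ M : ℝ, ∃ r > (0 : ℝ), ∀ x : ℕ,
          ∀ z ∈ Metric.ball a r ∩ {z : ℂ | -R' < z.re ∧ z.re < 7 / 4 ∧ |z.im| < η}, ‖H k f x z‖ ≤ M := by
  intro h
  obtain ⟨η, hη, hη4, hB⟩ := h 1 fX isBatemanHornSystem_fX
  refine fX_not_locallyBoundedOn (z₀ := ⟨-(2 - η ^ 2 / 32), η / 2⟩) ?_ ?_ hB
  · have hsq : (2 : ℝ) ^ 2 < ‖(⟨-(2 - η ^ 2 / 32), η / 2⟩ : ℂ)‖ ^ 2 := by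
      rw [Complex.sq_norm, Complex.normSq_mk]; nlinarith [sq_nonneg η, pow_pos hη 4]
    exact lt_of_pow_lt_pow_left₀ 2 (norm_nonneg _) hsq
  · refine ⟨?_, ?_, ?_⟩ <;> simp
    · nlinarith
    · nlinarith
    · rw [abs_of_pos (by linarith)]; linarith



/-! ## Cycle 2 (gen 2). Uniformity in `f` is false: the translates `X + c`

(Landed as `Theorems/NormalFamilyBound/Negative/Uniformity.lean`, p75839.) -/

/-- `ω_{X+c}(p) ≤ 1 < p`: two residues `a, b < p` with `p ∣ a + c`, `p ∣ b + c` coincide. [folklore] -/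
theorem polyRootCountMod_fXadd_le_one (c : ℤ) (p : ℕ) :
    polyRootCountMod (![X + C c] : Fin 1 → ℤ[X]) p ≤ 1 := by
  unfold polyRootCountMod
  refine Finset.card_le_one.mpr fun a ha b hb => ?_
  simp only [mem_filter, mem_range, Fin.prod_univ_one, Matrix.cons_val_fin_one, eval_add, eval_X,
    eval_C] at ha hb
  have hdvd : (p : ℤ) ∣ (a : ℤ) - (b : ℤ) := by
    have := dvd_sub ha.2 hb.2
    simpa using this
  have habs : |(a : ℤ) - (b : ℤ)| < (p : ℤ) := by
    rw [abs_lt]; constructor <;> omega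
  have := Int.eq_zero_of_abs_lt_dvd hdvd habs
  omega

/-- The translate `(X + c)` IS a Bateman–Horn system for every `c : ℤ` (degree 1, `k = 1`). [folklore] -/
theorem isBatemanHornSystem_fXadd (c : ℤ) : IsBatemanHornSystem (![X + C c] : Fin 1 → ℤ[X]) where
  irreducible i := by
    fin_cases i
    simpa using irreducible_X_sub_C (-c)
  leadingCoeff_pos i := by
    fin_cases i
    show 0 < (X + C c : ℤ[X]).leadingCoeff
    rw [leadingCoeff_X_add_C]; exact one_pos
  pairwise_not_associated := Subsingleton.pairwise
  hasNoFixedPrimeDivisor p hp := (polyRootCountMod_fXadd_le_one c p).trans_lt hp.one_lt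

/-- `Ω_{X+c}(n) = Ω(toNat (n + c))`. [folklore] -/
theorem Ωf_fXadd (c : ℤ) (n : ℕ) :
    Ωf (![X + C c] : Fin 1 → ℤ[X]) n = ArithmeticFunction.cardFactors ((n : ℤ) + c).toNat := by
  simp [Ωf]

/-- At a FIXED `x ≥ 1` and the real point `a = 3/2`, the translate `f = (X + (2^m − x))` has the single
term `n = x ↦ (3/2)^{Ω(2^m)} = (3/2)^m`, so `‖H_x(3/2)‖ ≥ x⁻¹ (log x)^{−1/2} (3/2)^m`. [folklore] -/
theorem norm_H_fXadd_ge (x : ℕ) (m : ℕ) :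
    (x : ℝ)⁻¹ * Real.exp ((1 : ℕ) * (1 - (3 / 2 : ℝ)) * Real.log (Real.log x)) * (3 / 2 : ℝ) ^ m ≤
      ‖H 1 (![X + C (2 ^ m - x : ℤ)] : Fin 1 → ℤ[X]) x (3 / 2 : ℝ)‖ := by
  set F : Fin 1 → ℤ[X] := ![X + C (2 ^ m - x : ℤ)] with hF
  rw [norm_H_ofReal _ _ _ (by norm_num)]
  have hterm : (3 / 2 : ℝ) ^ Ωf F x ≤ ∑ n ∈ range (x + 1), (3 / 2 : ℝ) ^ Ωf F n :=
    single_le_sum (f := fun n => (3 / 2 : ℝ) ^ Ωf F n) (fun n _ => by positivity) (by simp)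
  have hΩ : Ωf F x = m := by
    rw [hF]
    rw [Ωf_fXadd]
    have : ((x : ℕ) : ℤ) + (2 ^ m - x) = ((2 ^ m : ℕ) : ℤ) := by push_cast; ring
    rw [this, Int.toNat_natCast, ArithmeticFunction.cardFactors_apply_prime_pow Nat.prime_two]
  rw [hΩ] at hterm
  gcongr

/-- UNIFORMITY IN `f` IS FALSE, already at ONE `x ≥ 1` and ONE point: no constant bounds `‖H_x(3/2)‖` over
the Bateman–Horn systems `(X + c)` of degree one (`c = 2^m − x`: the value `2^m` sits at `n = x`). So the
constants `M, r` of the crux must depend on (the height of) `f`, not only on `k` and the degrees — the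
crude shadow of the Friedlander–Granville phenomenon (`Literature.Barriers.Parity.UniformBatemanHornBarrier`);
the crux, which lets `η, M, r` depend on `f`, is untouched. [folklore] -/
theorem normalFamilyBound_not_uniform_in_f (x : ℕ) (hx : 1 ≤ x) :
    ¬ ∃ M : ℝ, ∀ f : Fin 1 → ℤ[X], IsBatemanHornSystem f → ‖H 1 f x (3 / 2 : ℝ)‖ ≤ M := by
  rintro ⟨M, hM⟩
  set c : ℝ := (x : ℝ)⁻¹ * Real.exp ((1 : ℕ) * (1 - (3 / 2 : ℝ)) * Real.log (Real.log x)) with hc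
  have hc0 : 0 < c := by
    have : (0 : ℝ) < x := by exact_mod_cast hx
    positivity
  obtain ⟨m, hm⟩ := pow_unbounded_of_one_lt (M / c) (by norm_num : (1 : ℝ) < 3 / 2)
  have h1 := norm_H_fXadd_ge x m
  have h2 := hM _ (isBatemanHornSystem_fXadd (2 ^ m - x : ℤ))
  rw [div_lt_iff₀ hc0] at hm
  rw [← hc] at h1
  linarith [mul_comm c ((3 / 2 : ℝ) ^ m)]

/-- REFUTED STRENGTHENING: the crux made UNIFORM in `f` (`η, M, r` depending on `k` only) is false
(`k = 1`, `a = 3/2`, `x = 1`, `f = (X + 2^m − 1)`). [folklore] -/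
theorem not_normalFamilyBound_uniform :
    ¬ ∀ k : ℕ, ∃ η : ℝ, 0 < η ∧ η ≤ 1 / 4 ∧ ∀ a ∈ V (7 / 4) η, ∃ M : ℝ, ∃ r > (0 : ℝ),
      ∀ f : Fin k → ℤ[X], IsBatemanHornSystem f →
        ∀ x : ℕ, ∀ z ∈ Metric.ball a r ∩ V (7 / 4) η, ‖H k f x z‖ ≤ M := by
  intro h
  obtain ⟨η, hη, -, hB⟩ := h 1
  have haV : ((3 / 2 : ℝ) : ℂ) ∈ V (7 / 4) η := by
    refine ⟨?_, ?_, ?_⟩ <;> simp <;> linarith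
  obtain ⟨M, r, hr, hM⟩ := hB _ haV
  exact normalFamilyBound_not_uniform_in_f 1 le_rfl
    ⟨M, fun f hf => hM f hf 1 _ ⟨Metric.mem_ball_self hr, haV⟩⟩

/-! ## Cycle 2. The triangle inequality is hopeless off the real axis: the majorant family -/

/-- The triangle-inequality MAJORANT `Habs_x(z) := x⁻¹ (log x)^{k(1 − Re z)} Σ_{n ≤ x} |z|^{Ω_f(n)}` of `‖H_x(z)‖`:
what taking norms inside the sum gives (written out in full in every statement below). [folklore] -/
theorem norm_H_le_Habs (k : ℕ) (f : Fin k → ℤ[X]) (x : ℕ) (z : ℂ) :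
    ‖H k f x z‖ ≤ (x : ℝ)⁻¹ * Real.exp (k * (1 - z.re) * Real.log (Real.log x)) * ∑ n ∈ range (x + 1), ‖z‖ ^ Ωf f n := by
  set L : ℝ := Real.log (Real.log x)
  simp only [H, norm_mul, norm_inv, Complex.norm_natCast, Complex.norm_exp]
  have hre : ((k : ℂ) * (1 - z) * (L : ℂ)).re = k * (1 - z.re) * L := by
    simp [Complex.mul_re, Complex.mul_im]
  rw [hre]
  gcongr
  refine (norm_sum_le _ _).trans (le_of_eq ?_)
  simp [Ωf, norm_pow]

/-- On the unit circle the majorant forgets `f`: `Habs_x(z) = x⁻¹ (x+1) (log x)^{k(1 − Re z)}`. [folklore] -/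
theorem Habs_of_norm_eq_one (k : ℕ) (f : Fin k → ℤ[X]) (x : ℕ) {z : ℂ} (hz : ‖z‖ = 1) :
    (x : ℝ)⁻¹ * Real.exp (k * (1 - z.re) * Real.log (Real.log x)) * ∑ n ∈ range (x + 1), ‖z‖ ^ Ωf f n =
      (x : ℝ)⁻¹ * Real.exp (k * (1 - z.re) * Real.log (Real.log x)) * (x + 1) := by
  simp [hz]

/-- For `|z| = 1`, `Re z < 1`, `k ≥ 1` the majorant is unbounded in `x` for EVERY system `f`:
`Habs_x(z) ≥ (log x)^{k(1 − Re z)} → ∞`. [folklore] -/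
theorem Habs_unbounded {k : ℕ} (hk : 1 ≤ k) (f : Fin k → ℤ[X]) {z : ℂ} (hz : ‖z‖ = 1) (hre : z.re < 1) :
    ∀ M : ℝ, ∃ x : ℕ, M < (x : ℝ)⁻¹ * Real.exp (k * (1 - z.re) * Real.log (Real.log x)) * ∑ n ∈ range (x + 1), ‖z‖ ^ Ωf f n := by
  have ht : Tendsto (fun x : ℕ => Real.exp (k * (1 - z.re) * Real.log (Real.log x))) atTop atTop := by
    refine Real.tendsto_exp_atTop.comp (tendsto_loglog.const_mul_atTop ?_)
    have : (1 : ℝ) ≤ k := by exact_mod_cast hk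
    nlinarith
  intro M
  obtain ⟨x, hx1, hxM⟩ := ((eventually_ge_atTop 1).and (ht.eventually_gt_atTop M)).exists
  refine ⟨x, hxM.trans_le ?_⟩
  rw [Habs_of_norm_eq_one k f x hz]
  have hx' : (0 : ℝ) < x := by exact_mod_cast hx1
  set E : ℝ := Real.exp (k * (1 - z.re) * Real.log (Real.log x))
  have h1 : E ≤ E * ((x : ℝ)⁻¹ * (x + 1)) :=
    le_mul_of_one_le_right (Real.exp_nonneg _) (by rw [le_inv_mul_iff₀ hx']; linarith)
  calc E ≤ E * ((x : ℝ)⁻¹ * (x + 1)) := h1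
    _ = (x : ℝ)⁻¹ * E * (x + 1) := by ring

/-- Every thin rectangle `V_{7/4,η}` contains a point of the unit circle other than `1`:
`z = e^{iθ}`, `θ = min(η/2, 1)`. [folklore] -/
theorem exists_mem_V_norm_eq_one {η : ℝ} (hη : 0 < η) :
    ∃ z ∈ V (7 / 4) η, ‖z‖ = 1 ∧ z.re < 1 := by
  set θ : ℝ := min (η / 2) 1 with hθ
  have hθ0 : 0 < θ := lt_min (by linarith) one_pos
  have hθ1 : θ ≤ 1 := min_le_right _ _
  have hθη : θ ≤ η / 2 := min_le_left _ _
  have hpi : (1 : ℝ) < Real.pi / 2 := by have := Real.pi_gt_three; linarith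
  refine ⟨Complex.exp (θ * Complex.I), ⟨?_, ?_, ?_⟩, Complex.norm_exp_ofReal_mul_I θ, ?_⟩
  · rw [Complex.exp_ofReal_mul_I_re]
    have : 0 < Real.cos θ := Real.cos_pos_of_mem_Ioo ⟨by linarith, by linarith⟩
    linarith
  · rw [Complex.exp_ofReal_mul_I_re]
    have := Real.cos_le_one θ
    linarith
  · rw [Complex.exp_ofReal_mul_I_im]
    have h1 : |Real.sin θ| ≤ |θ| := Real.abs_sin_le_abs
    rw [abs_of_pos hθ0] at h1
    linarith
  · rw [Complex.exp_ofReal_mul_I_re]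
    have := Real.cos_lt_cos_of_nonneg_of_le_pi_div_two le_rfl (by linarith) hθ0
    rwa [Real.cos_zero] at this

/-- THE TRIANGLE INEQUALITY IS HOPELESS: for EVERY system `f` with `k ≥ 1` (Bateman–Horn or not) and
EVERY `η > 0`, the majorant family `Habs` is NOT locally bounded on `V_{7/4,η}` — it blows up at the
point `e^{iθ} ∈ V_η` of the unit circle, where `Σ_n |z|^{Ω_f(n)} = x + 1` exactly and the normaliser
`(log x)^{k(1 − cos θ)}` diverges. Any proof of the crux must produce the cancellation
`(log x)^{k(|z| − Re z)}` among the phases `e^{iθ Ω_f(n)}` (the route's exchange rate is real, not an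
artefact of a lossy bound). [folklore] -/
theorem Habs_not_locallyBoundedOn {k : ℕ} (hk : 1 ≤ k) (f : Fin k → ℤ[X]) {η : ℝ} (hη : 0 < η) :
    ¬ ∀ a ∈ V (7 / 4) η, ∃ M : ℝ, ∃ r > (0 : ℝ), ∀ x : ℕ, ∀ z ∈ Metric.ball a r ∩ V (7 / 4) η,
      (x : ℝ)⁻¹ * Real.exp (k * (1 - z.re) * Real.log (Real.log x)) * ∑ n ∈ range (x + 1), ‖z‖ ^ Ωf f n ≤ M := by
  intro hB
  obtain ⟨z₀, hV, hz1, hre⟩ := exists_mem_V_norm_eq_one hη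
  obtain ⟨M, r, hr, hM⟩ := hB z₀ hV
  obtain ⟨x, hx⟩ := Habs_unbounded hk f hz1 hre M
  have := hM x z₀ ⟨Metric.mem_ball_self hr, hV⟩
  linarith

/-- REFUTED STRENGTHENING: the crux with `‖H_x(z)‖` replaced by its triangle-inequality majorant `Habs` is
false (witness: the genuine Bateman–Horn system `f = (X)`, any `η`). [folklore] -/
theorem not_normalFamilyBound_abs :
    ¬ ∀ (k : ℕ) (f : Fin k → ℤ[X]), IsBatemanHornSystem f → ∃ η : ℝ, 0 < η ∧ η ≤ 1 / 4 ∧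
      ∀ a ∈ V (7 / 4) η, ∃ M : ℝ, ∃ r > (0 : ℝ), ∀ x : ℕ, ∀ z ∈ Metric.ball a r ∩ V (7 / 4) η,
        (x : ℝ)⁻¹ * Real.exp (k * (1 - z.re) * Real.log (Real.log x)) * ∑ n ∈ range (x + 1), ‖z‖ ^ Ωf f n ≤ M := by
  intro h
  obtain ⟨η, hη, -, hB⟩ := h 1 fX isBatemanHornSystem_fX
  exact Habs_not_locallyBoundedOn le_rfl fX hη hB

/-! ## Cycle 2. Calibration: a real point `ε` of the crux is an upper-bound sieve -/

/-- If every `f_i(n)` is a prime then `Ω_f(n) = k`. [folklore] -/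
theorem Ωf_eq_of_forall_prime {k : ℕ} (f : Fin k → ℤ[X]) {n : ℕ}
    (h : ∀ i, (((f i).eval (n : ℤ)).toNat).Prime) : Ωf f n = k := by
  simp only [Ωf]
  rw [Finset.sum_congr rfl fun i _ => ArithmeticFunction.cardFactors_apply_prime (h i)]
  simp

/-- CALIBRATION (what the crux contains at a REAL point `0 < ε < 7/4`): a bound `‖H_x(ε)‖ ≤ M` for all
`x` gives the upper-bound-sieve estimate `#{n ≤ x : every f_i(n) prime} ≤ M ε^{−k} · x · (log x)^{−k(1−ε)}`
(`x ≥ 1`). For `ε → 0` this is the Brun–Titchmarsh / Selberg order `x (log x)^{−k}` up to `(log x)^{kε}`: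
the real segment of the crux is sieve-strength information (known: Nair–Tenenbaum), the parity content
sits off the segment. [folklore] -/
theorem card_primeTuples_le_of_norm_H_le {k : ℕ} (f : Fin k → ℤ[X]) {ε M : ℝ} (hε : 0 < ε)
    (hM : ∀ x : ℕ, ‖H k f x ε‖ ≤ M) (x : ℕ) (hx : 1 ≤ x) :
    (#((range (x + 1)).filter fun n : ℕ => ∀ i, (((f i).eval (n : ℤ)).toNat).Prime) : ℝ) ≤
      M * (ε⁻¹) ^ k * x * Real.exp (-(k * (1 - ε) * Real.log (Real.log x))) := by
  set P := (range (x + 1)).filter fun n : ℕ => ∀ i, (((f i).eval (n : ℤ)).toNat).Prime with hP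
  set E : ℝ := Real.exp (k * (1 - ε) * Real.log (Real.log x)) with hE
  have hx' : (0 : ℝ) < x := by exact_mod_cast hx
  have hE0 : 0 < E := Real.exp_pos _
  have h1 := hM x
  rw [norm_H_ofReal _ _ _ hε.le] at h1
  -- the sum dominates ε^k · #P
  have hsum : ε ^ k * (#P : ℝ) ≤ ∑ n ∈ range (x + 1), ε ^ Ωf f n := by
    calc ε ^ k * (#P : ℝ) = ∑ n ∈ P, ε ^ k := by rw [sum_const, nsmul_eq_mul, mul_comm]
      _ = ∑ n ∈ P, ε ^ Ωf f n := by
          refine sum_congr rfl fun n hn => ?_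
          rw [Ωf_eq_of_forall_prime f (mem_filter.mp hn).2]
      _ ≤ ∑ n ∈ range (x + 1), ε ^ Ωf f n :=
          sum_le_sum_of_subset_of_nonneg (filter_subset _ _) fun n _ _ => by positivity
  have h2 : (x : ℝ)⁻¹ * E * (ε ^ k * (#P : ℝ)) ≤ M := by
    refine le_trans ?_ h1
    gcongr
  -- rearrange
  have hεk : 0 < ε ^ k := pow_pos hε k
  rw [Real.exp_neg, ← hE, inv_pow]
  have : (#P : ℝ) = ((x : ℝ)⁻¹ * E * (ε ^ k * (#P : ℝ))) * ((ε ^ k)⁻¹ * x * E⁻¹) := by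
    field_simp
  rw [this]
  calc (x : ℝ)⁻¹ * E * (ε ^ k * (#P : ℝ)) * ((ε ^ k)⁻¹ * x * E⁻¹)
      ≤ M * ((ε ^ k)⁻¹ * x * E⁻¹) := by gcongr
    _ = M * (ε ^ k)⁻¹ * x * E⁻¹ := by ring

/-- The crux at a real point, for members of `locallyBoundedSystems`: prime `k`-tuples of values are
`O_{f,ε}(x (log x)^{−k(1−ε)})` for every `0 < ε < 7/4`. [folklore] -/
theorem card_primeTuples_le_of_locallyBounded {k : ℕ} {f : Fin k → ℤ[X]}
    (hf : LocallyBounded (7 / 4) k f) {ε : ℝ} (hε0 : 0 < ε) (hε1 : ε < 7 / 4) :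
    ∃ M : ℝ, ∀ x : ℕ, 1 ≤ x →
      (#((range (x + 1)).filter fun n : ℕ => ∀ i, (((f i).eval (n : ℤ)).toNat).Prime) : ℝ) ≤
        M * (ε⁻¹) ^ k * x * Real.exp (-(k * (1 - ε) * Real.log (Real.log x))) := by
  obtain ⟨η, hη, -, hB⟩ := hf
  have haV : ((ε : ℝ) : ℂ) ∈ V (7 / 4) η := by
    refine ⟨?_, ?_, ?_⟩ <;> simp <;> linarith
  obtain ⟨M, r, hr, hM⟩ := hB _ haV
  exact ⟨M, fun x hx => card_primeTuples_le_of_norm_H_le f hε0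
    (fun x => hM x _ ⟨Metric.mem_ball_self hr, haV⟩) x hx⟩


/-! ## Cycle 2. Calibration at `f = (X)`: MV Thm 7.18 gives the crux for the integers

(Landed as `Theorems/NormalFamilyBound/Negative/Calibration.lean`, p76248.) -/


/-- The sum of the crux for `f = (X)` is `1 + A_z(x)`, `A_z(x) = Σ_{1 ≤ n ≤ x} z^{Ω(n)}` (the `n = 0` term
is `z^{Ω(0)} = z^0 = 1`). [folklore] -/
theorem sum_fX_eq (x : ℕ) (z : ℂ) :
    ∑ n ∈ range (x + 1), z ^ (∑ i, ArithmeticFunction.cardFactors (((fX i).eval (n : ℤ)).toNat)) =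
      1 + ∑ n ∈ Finset.Icc 1 x, z ^ ArithmeticFunction.cardFactors n := by
  have h : ∀ n : ℕ, (∑ i, ArithmeticFunction.cardFactors (((fX i).eval (n : ℤ)).toNat)) =
      ArithmeticFunction.cardFactors n := fun n => by simp [fX]
  simp_rw [h]
  rw [Nat.range_succ_eq_Icc_zero, Finset.Icc_eq_cons_Ioc (Nat.zero_le x), Finset.sum_cons,
    ← Finset.Icc_add_one_left_eq_Ioc, zero_add]
  simp

/-- `A_z(2) = 1 + z`. [folklore] -/
theorem sum_Icc_one_two (z : ℂ) : ∑ n ∈ Finset.Icc 1 2, z ^ ArithmeticFunction.cardFactors n = 1 + z := by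
  rw [show Finset.Icc 1 2 = {1, 2} from rfl, Finset.sum_pair (by norm_num)]
  simp [ArithmeticFunction.cardFactors_apply_prime Nat.prime_two]

/-- The thin rectangle `V_{7/4,1/4}` lies in the closed disc of radius `9/5` (and has `−1/4 < Re z < 7/4`).
[folklore] -/
theorem norm_le_of_mem_V {z : ℂ} (hz : z ∈ V (7 / 4) (1 / 4)) : ‖z‖ ≤ 9 / 5 := by
  obtain ⟨h1, h2, h3⟩ := hz
  have him := abs_lt.mp h3
  have hsq : ‖z‖ ^ 2 ≤ (9 / 5) ^ 2 := by
    rw [Complex.sq_norm, Complex.normSq_apply]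
    nlinarith [him.1, him.2]
  exact le_of_pow_le_pow_left₀ (by norm_num) (by norm_num) hsq

/-- STEP 1. The printed theorem at `x = 2` bounds the main-term coefficient `G(z) = F(1,z)/Γ(z)` uniformly:
`‖G(z)‖ ≤ (3/2)(log 2)^{−4/5} + |C| (log 2)^{−1}` for `‖z‖ ≤ 9/5` (no continuity of `F(1,·)` needed).
[cite: MontgomeryVaughan2007, §7.4 Theorem 7.18] -/
theorem norm_G_le {C : ℝ}
    (hC : ∀ x : ℝ, 2 ≤ x → ∀ z : ℂ, ‖z‖ ≤ 9 / 5 →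
      ‖(∑ n ∈ Finset.Icc 1 ⌊x⌋₊, z ^ (ArithmeticFunction.cardFactors n)) -
          selbergDelangeOmegaF z * (Complex.Gamma z)⁻¹ * (x : ℂ) * ((Real.log x : ℝ) : ℂ) ^ (z - 1)‖ ≤
        C * x * Real.log x ^ (z.re - 2))
    {z : ℂ} (hz : ‖z‖ ≤ 9 / 5) :
    ‖selbergDelangeOmegaF z * (Complex.Gamma z)⁻¹‖ ≤
      3 / 2 * Real.log 2 ^ (-(4 / 5) : ℝ) + |C| * (Real.log 2)⁻¹ := by
  set G : ℂ := selbergDelangeOmegaF z * (Complex.Gamma z)⁻¹ with hG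
  set l : ℝ := Real.log 2 with hl
  have hl0 : 0 < l := Real.log_pos one_lt_two
  have hl1 : l ≤ 1 := by
    have := Real.log_le_sub_one_of_pos (by norm_num : (0 : ℝ) < 2); rw [hl]; linarith
  have h2 := hC 2 le_rfl z hz
  have hfloor : ⌊(2 : ℝ)⌋₊ = 2 := by norm_num
  rw [hfloor, sum_Icc_one_two] at h2
  -- ‖G * 2 * l^(z-1)‖ = ‖G‖ * 2 * l^(Re z - 1)
  have hmain : ‖G * (2 : ℝ) * ((l : ℝ) : ℂ) ^ (z - 1)‖ = ‖G‖ * 2 * l ^ (z.re - 1) := by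
    rw [norm_mul, norm_mul, Complex.norm_cpow_eq_rpow_re_of_pos hl0]
    simp
  have htri : ‖G‖ * 2 * l ^ (z.re - 1) ≤ ‖(1 : ℂ) + z‖ + C * 2 * l ^ (z.re - 2) := by
    rw [← hmain]
    have := norm_sub_norm_le (G * (2 : ℝ) * ((l : ℝ) : ℂ) ^ (z - 1)) (1 + z)
    rw [norm_sub_rev] at this
    push_cast at h2 this ⊢
    linarith
  have h1z : ‖(1 : ℂ) + z‖ ≤ 3 := by
    calc ‖(1 : ℂ) + z‖ ≤ ‖(1 : ℂ)‖ + ‖z‖ := norm_add_le _ _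
      _ ≤ 1 + 9 / 5 := by rw [norm_one]; gcongr
      _ ≤ 3 := by norm_num
  -- multiply through by l^(1 - Re z) / 2
  have hpow1 : l ^ (z.re - 1) * l ^ (1 - z.re) = 1 := by
    rw [← Real.rpow_add hl0]; simp
  have hpow2 : l ^ (z.re - 2) * l ^ (1 - z.re) = l⁻¹ := by
    rw [← Real.rpow_add hl0, show z.re - 2 + (1 - z.re) = (-1 : ℝ) by ring, Real.rpow_neg_one]
  have hre : z.re ≤ 9 / 5 := (Complex.re_le_norm z).trans hz
  have hexp : l ^ (1 - z.re) ≤ l ^ (-(4 / 5) : ℝ) :=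
    Real.rpow_le_rpow_of_exponent_ge hl0 hl1 (by linarith)
  have hq : 0 < l ^ (1 - z.re) := Real.rpow_pos_of_pos hl0 _
  have key : ‖G‖ * 2 ≤ 3 * l ^ (-(4 / 5) : ℝ) + |C| * 2 * l⁻¹ := by
    have := mul_le_mul_of_nonneg_right htri hq.le
    rw [show ‖G‖ * 2 * l ^ (z.re - 1) * l ^ (1 - z.re) = ‖G‖ * 2 * (l ^ (z.re - 1) * l ^ (1 - z.re)) by ring,
      hpow1, mul_one, add_mul,
      show C * 2 * l ^ (z.re - 2) * l ^ (1 - z.re) = C * 2 * (l ^ (z.re - 2) * l ^ (1 - z.re)) by ring,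
      hpow2] at this
    have hC' : C * 2 * l⁻¹ ≤ |C| * 2 * l⁻¹ := by
      have := le_abs_self C
      have : 0 ≤ l⁻¹ := inv_nonneg.mpr hl0.le
      gcongr
    have h3 : ‖(1 : ℂ) + z‖ * l ^ (1 - z.re) ≤ 3 * l ^ (-(4 / 5) : ℝ) := by gcongr
    linarith
  linarith

/-- STEP 2 (small `x`). For `x ≤ 2` and `−1/4 < Re z < 7/4`, `‖z‖ ≤ 9/5`: `‖H_x(z)‖ ≤ 48` (three terms,
`Ω ≤ 1`, `|log log x| ≤ 1` in the junk/real cases `x = 0, 1, 2`). [folklore] -/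
theorem norm_H_fX_le_of_le_two {x : ℕ} (hx : x ≤ 2) {z : ℂ} (hz : ‖z‖ ≤ 9 / 5) (hre1 : -1 < z.re)
    (hre2 : z.re < 7 / 4) : ‖H 1 fX x z‖ ≤ 48 := by
  have hLabs : |Real.log (Real.log (x : ℝ))| ≤ 1 := by
    interval_cases x
    · simp
    · simp
    · rw [show ((2 : ℕ) : ℝ) = 2 by norm_num]
      have hl0 : (1 : ℝ) / 2 < Real.log 2 := by have := Real.log_two_gt_d9; linarith
      have hl1 : Real.log 2 ≤ 1 := by
        have := Real.log_le_sub_one_of_pos (by norm_num : (0 : ℝ) < 2); linarith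
      have hup : Real.log (Real.log 2) ≤ 0 := Real.log_nonpos (by linarith) hl1
      have hdown : -1 ≤ Real.log (Real.log 2) := by
        have h := Real.log_le_log (by norm_num : (0:ℝ) < 1 / 2) hl0.le
        have e : Real.log (1 / 2 : ℝ) = -Real.log 2 := by rw [one_div, Real.log_inv]
        rw [e] at h
        linarith
      exact abs_le.mpr ⟨hdown, by linarith⟩
  -- the normaliser
  have hN : ‖Complex.exp (((1 : ℕ) : ℂ) * (1 - z) * (Real.log (Real.log (x : ℝ)) : ℂ))‖ ≤ 8 := by
    rw [Complex.norm_exp]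
    have hre : (((1 : ℕ) : ℂ) * (1 - z) * (Real.log (Real.log (x : ℝ)) : ℂ)).re =
        (1 - z.re) * Real.log (Real.log (x : ℝ)) := by
      simp [Complex.mul_re]
    rw [hre]
    have h1 : |1 - z.re| ≤ 2 := by rw [abs_le]; constructor <;> linarith
    have h2 : (1 - z.re) * Real.log (Real.log (x : ℝ)) ≤ 2 := by
      calc (1 - z.re) * Real.log (Real.log (x : ℝ)) ≤ |(1 - z.re) * Real.log (Real.log (x : ℝ))| :=
            le_abs_self _
        _ = |1 - z.re| * |Real.log (Real.log (x : ℝ))| := abs_mul _ _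
        _ ≤ 2 * 1 := by gcongr
        _ = 2 := by norm_num
    have he2 : Real.exp 2 ≤ 8 := by
      have h := Real.exp_one_lt_d9
      have e : Real.exp 2 = Real.exp 1 * Real.exp 1 := by rw [← Real.exp_add]; norm_num
      rw [e]; nlinarith [Real.exp_pos 1]
    exact (Real.exp_le_exp.mpr h2).trans he2
  -- the sum: x + 1 ≤ 3 terms each of norm ≤ 2
  have hS : ‖∑ n ∈ range (x + 1), z ^ (∑ i, ArithmeticFunction.cardFactors (((fX i).eval (n : ℤ)).toNat))‖
      ≤ 6 := by
    have hterm : ∀ n ∈ range (x + 1),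
        ‖z ^ (∑ i, ArithmeticFunction.cardFactors (((fX i).eval (n : ℤ)).toNat))‖ ≤ 2 := by
      intro n hn
      have hn2 : n ≤ 2 := by have := mem_range.mp hn; omega
      have hΩ : (∑ i, ArithmeticFunction.cardFactors (((fX i).eval (n : ℤ)).toNat)) ≤ 1 := by
        simp only [fX, Fin.sum_univ_one, Matrix.cons_val_fin_one, eval_X, Int.toNat_natCast]
        interval_cases n <;> simp [ArithmeticFunction.cardFactors_apply_prime Nat.prime_two]
      rw [norm_pow]
      rcases Nat.le_one_iff_eq_zero_or_eq_one.mp hΩ with h | h <;> rw [h]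
      · simp
      · rw [pow_one]; linarith
    calc _ ≤ ∑ n ∈ range (x + 1), ‖z ^ (∑ i, ArithmeticFunction.cardFactors (((fX i).eval (n : ℤ)).toNat))‖ :=
          norm_sum_le _ _
      _ ≤ ∑ n ∈ range (x + 1), (2 : ℝ) := sum_le_sum hterm
      _ = 2 * (x + 1) := by simp; ring
      _ ≤ 6 := by
          have : (x : ℝ) ≤ 2 := by exact_mod_cast hx
          linarith
  have hxinv : ‖((x : ℕ) : ℂ)⁻¹‖ ≤ 1 := by
    rw [norm_inv, Complex.norm_natCast]
    rcases Nat.eq_zero_or_pos x with rfl | hx0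
    · simp
    · exact inv_le_one_of_one_le₀ (by exact_mod_cast hx0)
  simp only [H]
  rw [norm_mul, norm_mul]
  calc _ ≤ 1 * 8 * 6 :=
        mul_le_mul (mul_le_mul hxinv hN (norm_nonneg _) zero_le_one) hS (norm_nonneg _) (by norm_num)
    _ = 48 := by norm_num

/-- `x⁻¹ (log x)^t ≤ 4` for `x ≥ 3`, `t ≤ 2` (as `log x ≤ 2 √x` and `log x ≥ 1`). [folklore] -/
theorem inv_mul_log_rpow_le {x : ℕ} (hx : 3 ≤ x) {t : ℝ} (ht : t ≤ 2) :
    (x : ℝ)⁻¹ * Real.log x ^ t ≤ 4 := by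
  have hx0 : (0 : ℝ) < x := by exact_mod_cast (by omega : 0 < x)
  have hx3 : (3 : ℝ) ≤ x := by exact_mod_cast hx
  have hlog3 : (1 : ℝ) < Real.log 3 := by
    rw [Real.lt_log_iff_exp_lt (by norm_num)]
    have := Real.exp_one_lt_d9; linarith
  have hl1 : 1 ≤ Real.log x := hlog3.le.trans (Real.log_le_log (by norm_num) hx3)
  have h1 : Real.log x ^ t ≤ Real.log x ^ (2 : ℝ) := Real.rpow_le_rpow_of_exponent_le hl1 ht
  have h2 : Real.log x ≤ 2 * (x : ℝ) ^ (1 / 2 : ℝ) := by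
    have := Real.log_le_rpow_div hx0.le (by norm_num : (0 : ℝ) < 1 / 2)
    linarith
  have h3 : Real.log x ^ (2 : ℝ) ≤ 4 * x := by
    rw [Real.rpow_two]
    have hs : ((x : ℝ) ^ (1 / 2 : ℝ)) ^ 2 = x := by
      rw [← Real.rpow_natCast, ← Real.rpow_mul hx0.le]; norm_num
    have h0 : 0 ≤ Real.log x := by linarith
    nlinarith [hs, h2, h0]
  rw [inv_mul_le_iff₀ hx0]
  linarith

/-- STEP 3 (large `x`). For `x ≥ 3`, `z ∈ V_{7/4,1/4}`: `‖H_x(z)‖ ≤ 4 + |C| + K` where `K` bounds `‖G‖`.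
[cite: MontgomeryVaughan2007, §7.4 Theorem 7.18] -/
theorem norm_H_fX_le_of_three_le {C K : ℝ}
    (hC : ∀ x : ℝ, 2 ≤ x → ∀ z : ℂ, ‖z‖ ≤ 9 / 5 →
      ‖(∑ n ∈ Finset.Icc 1 ⌊x⌋₊, z ^ (ArithmeticFunction.cardFactors n)) -
          selbergDelangeOmegaF z * (Complex.Gamma z)⁻¹ * (x : ℂ) * ((Real.log x : ℝ) : ℂ) ^ (z - 1)‖ ≤
        C * x * Real.log x ^ (z.re - 2))
    (hK : ∀ z : ℂ, ‖z‖ ≤ 9 / 5 → ‖selbergDelangeOmegaF z * (Complex.Gamma z)⁻¹‖ ≤ K)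
    {x : ℕ} (hx : 3 ≤ x) {z : ℂ} (hzV : z ∈ V (7 / 4) (1 / 4)) :
    ‖H 1 fX x z‖ ≤ 4 + |C| + K := by
  have hz : ‖z‖ ≤ 9 / 5 := norm_le_of_mem_V hzV
  obtain ⟨hre1, hre2, -⟩ := hzV
  have hx0 : (0 : ℝ) < x := by exact_mod_cast (by omega : 0 < x)
  have hx3 : (3 : ℝ) ≤ x := by exact_mod_cast hx
  -- the printed theorem at x (BEFORE naming the pieces, so that `set` abstracts inside it)
  have h2 := hC x (by linarith) z hz
  rw [Nat.floor_natCast] at h2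
  set G : ℂ := selbergDelangeOmegaF z * (Complex.Gamma z)⁻¹ with hG
  set l : ℝ := Real.log (x : ℝ) with hl
  set L : ℝ := Real.log l with hL
  have hlog3 : (1 : ℝ) < Real.log 3 := by
    rw [Real.lt_log_iff_exp_lt (by norm_num)]
    have := Real.exp_one_lt_d9; linarith
  have hl1 : 1 ≤ l := hlog3.le.trans (Real.log_le_log (by norm_num) hx3)
  have hl0 : 0 < l := by linarith
  have hK0 : 0 ≤ K := (norm_nonneg _).trans (hK z hz)
  set A : ℂ := ∑ n ∈ Finset.Icc 1 x, z ^ ArithmeticFunction.cardFactors n with hA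
  -- norms of the pieces
  have hN : ‖Complex.exp (((1 : ℕ) : ℂ) * (1 - z) * (L : ℂ))‖ = l ^ (1 - z.re) := by
    rw [Complex.norm_exp]
    have hre : (((1 : ℕ) : ℂ) * (1 - z) * (L : ℂ)).re = (1 - z.re) * L := by
      simp [Complex.mul_re]
    rw [hre, Real.rpow_def_of_pos hl0, mul_comm]
  have hmainnorm : ‖G * (x : ℝ) * ((l : ℝ) : ℂ) ^ (z - 1)‖ = ‖G‖ * x * l ^ (z.re - 1) := by
    rw [norm_mul, norm_mul, Complex.norm_cpow_eq_rpow_re_of_pos hl0, Complex.norm_real, Real.norm_eq_abs,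
      abs_of_pos hx0]
    simp
  have hAle : ‖A‖ ≤ C * x * l ^ (z.re - 2) + ‖G‖ * x * l ^ (z.re - 1) := by
    have := norm_le_norm_sub_add A (G * (x : ℝ) * ((l : ℝ) : ℂ) ^ (z - 1))
    rw [hmainnorm] at this
    linarith
  have hS : ‖∑ n ∈ range (x + 1), z ^ (∑ i, ArithmeticFunction.cardFactors (((fX i).eval (n : ℤ)).toNat))‖
      ≤ 1 + C * x * l ^ (z.re - 2) + ‖G‖ * x * l ^ (z.re - 1) := by
    rw [sum_fX_eq, ← hA]
    calc ‖1 + A‖ ≤ ‖(1 : ℂ)‖ + ‖A‖ := norm_add_le _ _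
      _ ≤ 1 + (C * x * l ^ (z.re - 2) + ‖G‖ * x * l ^ (z.re - 1)) := by rw [norm_one]; gcongr
      _ = _ := by ring
  -- assemble
  have hH : ‖H 1 fX x z‖ ≤
      (x : ℝ)⁻¹ * l ^ (1 - z.re) * (1 + C * x * l ^ (z.re - 2) + ‖G‖ * x * l ^ (z.re - 1)) := by
    simp only [H]
    rw [norm_mul, norm_mul, hN, norm_inv, Complex.norm_natCast]
    gcongr
  have hp1 : l ^ (1 - z.re) * l ^ (z.re - 1) = 1 := by rw [← Real.rpow_add hl0]; simp
  have hp2 : l ^ (1 - z.re) * l ^ (z.re - 2) = l⁻¹ := by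
    rw [← Real.rpow_add hl0, show 1 - z.re + (z.re - 2) = (-1 : ℝ) by ring, Real.rpow_neg_one]
  have hexpand : (x : ℝ)⁻¹ * l ^ (1 - z.re) * (1 + C * x * l ^ (z.re - 2) + ‖G‖ * x * l ^ (z.re - 1))
      = (x : ℝ)⁻¹ * l ^ (1 - z.re) + C * (l ^ (1 - z.re) * l ^ (z.re - 2)) * ((x : ℝ)⁻¹ * x)
        + ‖G‖ * (l ^ (1 - z.re) * l ^ (z.re - 1)) * ((x : ℝ)⁻¹ * x) := by ring
  rw [hexpand, hp1, hp2, inv_mul_cancel₀ hx0.ne', mul_one, mul_one, mul_one] at hH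
  have ht1 : (x : ℝ)⁻¹ * l ^ (1 - z.re) ≤ 4 := inv_mul_log_rpow_le hx (by linarith)
  have ht2 : C * l⁻¹ ≤ |C| := by
    have hlinv : l⁻¹ ≤ 1 := inv_le_one_of_one_le₀ hl1
    have hlinv0 : 0 ≤ l⁻¹ := inv_nonneg.mpr hl0.le
    calc C * l⁻¹ ≤ |C| * l⁻¹ := by gcongr; exact le_abs_self C
      _ ≤ |C| * 1 := by gcongr
      _ = |C| := mul_one _
  have ht3 : ‖G‖ ≤ K := hK z hz
  linarith

/-- CALIBRATION AT `f = (X)` (the grounder's "item = fact ∘ specialisation", checked): the printed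
Selberg–Delange law for `Σ_{n≤x} z^{Ω(n)}` (Montgomery–Vaughan Thm 7.18 with (7.60), `|z| ≤ R < 2`, vendored
fact `MontgomeryVaughan2007_thm_7_18_Omega`) implies that the genuine Bateman–Horn system `(X)` belongs to
`locallyBoundedSystems (7/4) 1` — i.e. the `k = 1`, `f = X` instance of the crux, with EXACTLY the crux's
normalisation `x⁻¹ (log x)^{1−z}`, its junk terms (`n = 0`, `x ≤ 2`) and its rectangle (`V_{7/4,1/4} ⊂
{|z| ≤ 9/5}`). A mis-normalised crux would have been refuted by this computation; it is not.
[cite: MontgomeryVaughan2007, §7.4 Theorem 7.18 and (7.60)] -/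
theorem locallyBounded_fX_of_MV (hMV : MontgomeryVaughan2007_thm_7_18_Omega) :
    LocallyBounded (7 / 4) 1 fX := by
  obtain ⟨C, hC⟩ := hMV (9 / 5) (by norm_num)
  set K : ℝ := 3 / 2 * Real.log 2 ^ (-(4 / 5) : ℝ) + |C| * (Real.log 2)⁻¹
  have hK : ∀ z : ℂ, ‖z‖ ≤ 9 / 5 → ‖selbergDelangeOmegaF z * (Complex.Gamma z)⁻¹‖ ≤ K :=
    fun z hz => norm_G_le hC hz
  refine ⟨1 / 4, by norm_num, le_rfl, fun a _ => ⟨48 + (4 + |C| + K), 1, one_pos, fun x z hz => ?_⟩⟩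
  have hzV := hz.2
  have hK0 : 0 ≤ K := (norm_nonneg _).trans (hK z (norm_le_of_mem_V hzV))
  rcases le_or_gt x 2 with hx | hx
  · have := norm_H_fX_le_of_le_two hx (norm_le_of_mem_V hzV) (by linarith [hzV.1]) hzV.2.1
    have : 0 ≤ |C| := abs_nonneg C
    linarith
  · have := norm_H_fX_le_of_three_le (x := x) hC hK (by omega) hzV
    linarith


/-! ## Cycle 2. Shape of the target: local boundedness = one bound on thin closed rectangles

(Landed as `Theorems/NormalFamilyBound/Negative/Shape.lean`, p78238.) -/


/-- GLOBAL ⇒ LOCAL (the form a prover will actually establish): a uniform bound `‖H_x(z)‖ ≤ M` for all `x` and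
all `z` in some thin rectangle `V_{R,η}`, `η > 0`, gives `LocallyBounded R k f`. [folklore] -/
theorem locallyBounded_of_uniform {R : ℝ} {k : ℕ} {f : Fin k → ℤ[X]} {η M : ℝ} (hη : 0 < η)
    (h : ∀ x : ℕ, ∀ z ∈ V R η, ‖H k f x z‖ ≤ M) : LocallyBounded R k f := by
  refine ⟨min η (1 / 4), lt_min hη (by norm_num), min_le_right _ _, fun a _ => ⟨M, 1, one_pos, fun x z hz => ?_⟩⟩
  obtain ⟨h1, h2, h3⟩ := hz.2
  have hle : min η (1 / 4) ≤ η := min_le_left _ _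
  exact h x z ⟨by linarith, h2, by linarith⟩

/-- LOCAL ⇒ GLOBAL on compact sub-rectangles: local boundedness on `V_{R,η}` (ball form, as in the crux) gives ONE
bound `M` valid for all `x` on the closed rectangle `[−η', R'] × [−η', η']` whenever `η' < η`, `R' < R` (finite
subcover). Together with `locallyBounded_of_uniform`: up to shrinking the rectangle, the crux asks for
`sup_x sup_{z ∈ [−η,R] × [−η,η]} ‖H_x(z)‖ < ∞`; only the open right edge `Re z → 7/4` is not captured this way.
[folklore] -/
theorem uniform_of_locallyBoundedOn {R η : ℝ} {k : ℕ} {f : Fin k → ℤ[X]}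
    (hB : ∀ a ∈ V R η, ∃ M : ℝ, ∃ r > (0 : ℝ), ∀ x : ℕ, ∀ z ∈ Metric.ball a r ∩ V R η, ‖H k f x z‖ ≤ M)
    {R' η' : ℝ} (hR : R' < R) (hη' : η' < η) :
    ∃ M : ℝ, ∀ x : ℕ, ∀ z : ℂ, -η' ≤ z.re → z.re ≤ R' → |z.im| ≤ η' → ‖H k f x z‖ ≤ M := by
  classical
  set K : Set ℂ := {z : ℂ | -η' ≤ z.re ∧ z.re ≤ R' ∧ |z.im| ≤ η'} with hK
  have hKV : K ⊆ V R η := fun z ⟨h1, h2, h3⟩ => ⟨by linarith, by linarith, by linarith⟩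
  have hKclosed : IsClosed K := by
    have e : K = (Complex.re ⁻¹' Set.Icc (-η') R') ∩ ((fun z : ℂ => |z.im|) ⁻¹' Set.Iic η') := by
      ext z; simp [hK, and_assoc]
    rw [e]
    exact (isClosed_Icc.preimage Complex.continuous_re).inter
      (isClosed_Iic.preimage (continuous_abs.comp Complex.continuous_im))
  have hKbdd : Bornology.IsBounded K := by
    refine Metric.isBounded_iff_subset_closedBall (0 : ℂ) |>.mpr ⟨|η'| + |R'| + |η'|, fun z hz => ?_⟩
    obtain ⟨h1, h2, h3⟩ := hz
    rw [Metric.mem_closedBall, dist_zero_right]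
    have h := Complex.norm_le_abs_re_add_abs_im z
    have hre : |z.re| ≤ |η'| + |R'| := by
      rw [abs_le]; constructor
      · have := le_abs_self η'; have := abs_nonneg R'; linarith
      · have := le_abs_self R'; have := abs_nonneg η'; linarith
    have him : |z.im| ≤ |η'| := h3.trans (le_abs_self η')
    linarith
  have hKc : IsCompact K := Metric.isCompact_of_isClosed_isBounded hKclosed hKbdd
  -- local data at every point (junk outside V)
  have hch : ∀ a : ℂ, ∃ M : ℝ, ∃ r : ℝ, 0 < r ∧ (a ∈ V R η → ∀ x : ℕ, ∀ z ∈ Metric.ball a r ∩ V R η, ‖H k f x z‖ ≤ M) := by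
    intro a
    by_cases ha : a ∈ V R η
    · obtain ⟨M, r, hr, hM⟩ := hB a ha
      exact ⟨M, r, hr, fun _ => hM⟩
    · exact ⟨0, 1, one_pos, fun h => absurd h ha⟩
  choose M r hr hM using hch
  obtain ⟨t, htK, hcover⟩ := hKc.elim_nhds_subcover (fun a => Metric.ball a (r a))
    (fun a _ => Metric.ball_mem_nhds a (hr a))
  refine ⟨∑ a ∈ t, |M a|, fun x z h1 h2 h3 => ?_⟩
  have hzK : z ∈ K := ⟨h1, h2, h3⟩
  obtain ⟨a, hat, hza⟩ : ∃ a ∈ t, z ∈ Metric.ball a (r a) := by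
    have := hcover hzK
    simpa using this
  have haV : a ∈ V R η := hKV (htK a hat)
  calc ‖H k f x z‖ ≤ M a := hM a haV x z ⟨hza, hKV hzK⟩
    _ ≤ |M a| := le_abs_self _
    _ ≤ ∑ b ∈ t, |M b| := Finset.single_le_sum (f := fun b => |M b|) (fun b _ => abs_nonneg (M b)) hat

/-- WHAT THE CRUX HANDS OVER: for every Bateman–Horn system and every `R' < 7/4`, one constant bounding `‖H_x(z)‖` for
all `x` on the closed rectangle `[−η', R'] × [−η', η']`, for some `η' = η'(f) > 0`. [folklore] -/
theorem uniform_on_closedRectangle_of_normalFamilyBound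
    (h : NormalFamilyBound) {k : ℕ} {f : Fin k → ℤ[X]} (hf : IsBatemanHornSystem f) {R' : ℝ} (hR : R' < 7 / 4) :
    ∃ η' : ℝ, 0 < η' ∧ ∃ M : ℝ, ∀ x : ℕ, ∀ z : ℂ,
      -η' ≤ z.re → z.re ≤ R' → |z.im| ≤ η' → ‖H k f x z‖ ≤ M := by
  obtain ⟨η, hη, -, hB⟩ := h k f hf
  obtain ⟨M, hM⟩ := uniform_of_locallyBoundedOn hB hR (by linarith : η / 2 < η)
  exact ⟨η / 2, by linarith, M, hM⟩

end

end Summit.Parity.BatemanHorn.Cruxes.NormalFamilyBound.Disproof
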